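import Literature.NumberTheory.Rogawski1990.RankOneKappaOrbitalUnfoldingTree            -- ★ p844070 B-p14 (g33) (Ψ1): `integral_conj_eq_sum_ncard_shell_smul_onePlace` (general `f`, `H_v` one-place reading)
import Literature.NumberTheory.Rogawski1990.RankOneUnstableTransferInertCoreAssembly     -- ★ A-p16 (g27): `isCompact_setOf_conj_mem_of_mem_centralizer` ∕ `…_map_…` (proper orbit maps on the elliptic torus)
import Literature.NumberTheory.Automorphic.UnitaryTwoRamifiedTreeShellDecomposition      -- ★ B-p08 (g28): `exists_comm_rhoVertexActPlace_mul_eq` (`hshell`), `rhoVertexActPlace_inv_pow_root_eq` (`r_m`)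
import Literature.NumberTheory.Automorphic.SLTwoTreeQuadraticTorusShellBall              -- ★ p844146 A-p17 (g23) (B6-C): shell balls `{M | d M ≤ M₁}`, `hSV`, `hs`, counts `2·q^m` (over ★ III `exists_shellIndex`, ★ V-INDEX)
import Literature.NumberTheory.Automorphic.SLTwoTreeQuadraticTorusShellSeam              -- ★ A-p17 (g23) IV: `exists_shellRep_fn`
import Literature.NumberTheory.Automorphic.RamifiedPlaceEisensteinBasis                  -- ★ B-p17 (g25) (W′1-CM0): `valued_toPlace_eq_sq_of_ramified`
import Literature.NumberTheory.Automorphic.UnitaryTwoRamifiedTreeStabilizers             -- ★ p843857 F0P3a-p04 (g14): `coe_glDiagonal_one_two`, `coe_glDiagonal_one_two_inv`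
import Literature.NumberTheory.Automorphic.AdicCompletionResidueCard                     -- ★ `natCard_valuativeResidueField_adicCompletion_eq` (`q_v`)
import HarnessLib

/-!
# (B6-H) THE `H_v` SHELL DRESS ALONG THE ELLIPTIC TORUS: `O(↑t,f) − O(e ↑t,f)` as a finite sum of shell averages with the Labesse–Langlands weights `2·q^m`
# (road «W′» = «R1LL-WILD», sub-socket (B6-H) of (W′-B6) «THE WILD LAW ON THE TORUS»; Labesse–Langlands 1979 §2 p. 8, Rogawski 1990 §4.9 p. 54)

Topic `NumberTheory/Rogawski1990`; namespace `Literature.NumberTheory.Rogawski1990` (sibling of ★ `RankOneKappaOrbitalUnfoldingTree`).  THEOREMS ONLY (no definition,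
no instance, no notation, no named fact, no `sorry`); kernel lane `--supports stmt-HodgeConjecture-24833`.
Cell `pub/hodgecm-mathlib` (D-0151), crux H413 = `stmt-HodgeConjecture-24833`, line «N6nsGerm», the WILDLY RAMIFIED residue `stub_N6nsR1ramWild`
(`RankOneUnstableTransferNonsplitCMERamifiedWild`, ★ def p843764); LEAD F0P3a-plan (g10) WORD T9-25; architect A-p16 (g28) RULINGS A-43∕A-44; (W′-B6) owner F0P3-p01 (g14),
sub-socket map 12:05:01Z and contract v2 ★-to-be `exists_wildLaw_torus_of_shellLaws` (rf 4e826c9e) binder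
`hShell : ∀ t ∈ U, ∀ M₁, Mb t ≤ M₁ → (∫ f(y·↑t·y⁻¹) − ∫ f(y·e ↑t·y⁻¹)) = Σ m ∈ range (M₁+1), ((2 * q ^ m : ℕ) : ℂ) * (fbar m ↑t − fbar m (e ↑t))`; seat A-p13 (g32).
HONEST LABEL: HC_CM is proved only modulo the cell's 2 remaining named inputs (hLiu418, h413) until rung 0 closes; this file is transport and asserts nothing printed.

THE MATHEMATICS [LabesseLanglands1979 §2 p. 8; Rogawski1990 §4.9 p. 54].  ★ `integral_conj_eq_sum_ncard_shell_smul_onePlace` (B-p14 (g33)) unfolds `∫_{H_v} f(y x y⁻¹) dν(y)`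
into `Σ_i #{M ∈ SV | d M = i} • f̄_i(x)` under five hypotheses `hF hSV hsupp hshellU hs`.  Here they are DISCHARGED for `x = ↑t` and `x = e ↑t`, `t` a regular element of
the elliptic torus `Z(t₀)` of a frame `(t₀, P, d)`, `e = Ad(diag(1, u))` the unit-similitude partner of ★ R-0 (`u ∈ L_wˣ` a `σ_w`-fixed unit):
* `hF` — `y ↦ f(y⁻¹ x y)` is continuous with compact support (`f` locally constant with compact support, the orbit map of a regular elliptic element is proper:
  ★ `isCompact_setOf_conj_mem_of_mem_centralizer` ∕ `…_map_…`);
* `SV := {M | d M ≤ M₁}` the SHELL BALL of ★ p844146 (A-p17 (g23)), `d` THE shell index of ★ III `exists_shellIndex` for an Eisenstein datum `(τ_E; u₀, v₀)` of `L_w ∕ L⁺_v`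
  (`τ_E² = ι u₀ τ_E + ι v₀`, `σ_w τ_E = ι u₀ − τ_E`, `u₀ ∈ 𝔭_v`, `|v₀| = |ϖ_v|`, integral basis `hE`): finite (`hSV`), `hs` with `s := range (M₁ + 1)`, and the COUNTS
  `#{M ∈ SV | d M = m} = 2·q^m` (`m ≤ M₁`; ★ (B6-C));
* `hsupp` — the vertices `ρ_w(E₂ y.1)·x₀` met by the integrand lie in the ball of radius `Mb t`: `y ↦ d(ρ_w(E₂ y.1)·x₀)` is locally constant (constant on the left cosets of the
  open stabiliser `K × U(Φ₁)_v`), so it is bounded on the compact set `{y | y⁻¹ x y ∈ tsupport f}`;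
* `hshellU` — ★ B-p08 `exists_comm_rhoVertexActPlace_mul_eq` along `E₂`, with `rU m := ũ_η⁻¹ ^ m` (★ `rhoVertexActPlace_inv_pow_root_eq`), GIVEN that the descent of `E₂ (↑t).1`
  lies in Labesse–Langlands' torus `{(a, b v₀; b, a + b u₀)}` of the datum — the STANDARD-POSITION hypothesis `hpos` (binder shared with (B6-V); the END head reduces an
  arbitrary frame to it by one `H_v`-conjugation, brick (B6-P)).  For the partner `e ↑t = Ad(diag(1,u)) ↑t` the descent lies in the torus of the RESCALED datum
  `(τ_E∕ι u_F; u₀∕u_F, v₀∕u_F²)` (`ι u_F = u`), again Eisenstein with the same weights `2·q^m`, same root, same `rU`.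
Subtracting the two unfoldings gives the (W′-B6) binder `hShell` VERBATIM, with `fbar m x := ∫_{K × U(Φ₁)_v} f(k⁻¹ ((E₂⁻¹(ũ_η⁻¹ ^ m), 1)⁻¹ x (E₂⁻¹(ũ_η⁻¹ ^ m), 1)) k) dν(k)`
(★ p844070's summand) and `q = #(𝓞_{L⁺} ∕ v)` (★ `natCard_valuativeResidueField_adicCompletion_eq`).

* §1 `exists_integral_conj_eq_sum_shells_of_descent` — ONE orbital integral in standard position (any `x ∈ H_v` with proper orbit map): `∃ B, ∀ M₁ ≥ B,
  ∫ f(y x y⁻¹) dν = Σ_{m ≤ M₁} (2·q_v^m) • f̄_m(x)`.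
* §2 the `u`-rescaled datum: `descent_conj_glDiagonal_eq`, `coe_glDiagonal_conj_regRep`, `eisenstein_rescale`, `integralBasis_rescale`, `quadDatum_rescale`.
* §3 **`exists_bound_integral_conj_sub_eq_sum_shells_of_mem_centralizer`** — the (B6-H) head in F0P3-p01 (g14)'s binder text.

## References
* [LabesseLanglands1979] J.-P. Labesse, R. P. Langlands, *L-indistinguishability for SL(2)*, Canad. J. Math. 31 (1979): §2 p. 8 (`∫_{T∖G} f = Σ_m δ_m ∫_K f(k⁻¹ α_m⁻¹ t α_m k)`, `δ_m = 2q^m`).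
* [Rogawski1990] J. D. Rogawski, *Automorphic Representations of Unitary Groups in Three Variables* (1990): §4.9 p. 54 (the unfolding of `Φ(γ, f)` over `H∖G∕K`).
* [Kottwitz1986] R. E. Kottwitz, *Base change for unit elements of Hecke algebras*, Compositio Math. 60 (1986): §3 (orbital integrals as weighted fixed-point counts on the building).
* [Serre1980Trees] J.-P. Serre, *Trees* (1980): Ch. II §1.1–§1.3.
-/

set_option autoImplicit false

noncomputable section

open MeasureTheory Topology Set Function NumberField IsDedekindDomain Matrix ValuativeRel
open scoped MatrixGroups Matrix ValuativeRel Pointwise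

namespace Literature.NumberTheory.Rogawski1990

open Literature.NumberTheory.Automorphic Literature.NumberTheory.Automorphic.UnitaryGroup Literature.NumberTheory.GaloisRepresentations
  Literature.NumberTheory.Automorphic.HermitianLatticeTree

/-! ## §0 Two scalar helpers -/

/-- in `ℤₘ₀`: `x ^ 2 = 1 ⇒ x = 1`. [folklore] -/
private theorem eq_one_of_sq_eq_one₃₂ {x : WithZero (Multiplicative ℤ)} (h : x ^ 2 = 1) : x = 1 := by
  rcases lt_trichotomy x 1 with hx | hx | hx
  · exact absurd h (by rw [← one_pow 2]; exact (pow_lt_pow_left₀ hx zero_le two_ne_zero).ne)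
  · exact hx
  · exact absurd h (by rw [← one_pow 2]; exact (pow_lt_pow_left₀ hx zero_le two_ne_zero).ne')

/-- `#𝓀(L⁺_v) = #(𝓞_{L⁺} ∕ v)` for the residue field of the `ValuativeRel` valuation ring of `L⁺_v` (★ `natCard_valuativeResidueField_adicCompletion_eq`: completing does not change
the residue field). [cite: Serre1979, Ch. II §1] [cite: NeukirchANT1999, Ch. II (4.3)] -/
theorem natCard_residueField_integer_adicCompletion_eq (L : Type) [Field L] [NumberField L] (v : HeightOneSpectrum (𝓞 ↥(maximalRealSubfield L))) :
    Nat.card (IsLocalRing.ResidueField 𝒪[v.adicCompletion ↥(maximalRealSubfield L)]) = Nat.card (𝓞 ↥(maximalRealSubfield L) ⧸ v.asIdeal) := by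
  rw [natCard_valuativeResidueField_adicCompletion_eq, HeightOneSpectrum.residueCard_eq_card_quotient]

/-- The residue field of `𝒪[L⁺_v]` is finite (a number field has finite residue fields; completing does not change them). [cite: Serre1979, Ch. II §1] [cite: NeukirchANT1999, Ch. II (4.3)] -/
theorem finite_residueField_integer_adicCompletion (L : Type) [Field L] [NumberField L] (v : HeightOneSpectrum (𝓞 ↥(maximalRealSubfield L))) :
    Finite (IsLocalRing.ResidueField 𝒪[v.adicCompletion ↥(maximalRealSubfield L)]) := by
  refine Nat.finite_of_card_ne_zero ?_
  rw [natCard_valuativeResidueField_adicCompletion_eq]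
  have h := v.one_lt_residueCard
  omega

section Place

variable (L : Type) [Field L] [NumberField L] [IsCMField L] (v : HeightOneSpectrum (𝓞 ↥(maximalRealSubfield L)))
  (w : PlacesOver L v) (hw : IsCMField.complexConj L • w.1 = w.1)
  {α : w.1.adicCompletion L} (hα : galAdicCompletionMap (L := L) (IsCMField.complexConj L) hw α = -α) (hα0 : α ≠ 0)
  {ϖF : v.adicCompletion ↥(maximalRealSubfield L)} (hϖF : Valued.v ϖF = WithZero.exp (-1 : ℤ))
  (he : v.asIdeal.ramificationIdx' w.1.asIdeal ≠ 1)
  [MeasurableSpace ((cmDatum L 2 (Matrix.of fun i j : Fin 2 => if i.val + j.val + 1 = 2 then (1 : L) else 0)).Local v × (cmDatum L 1 (Matrix.of fun i j : Fin 1 => if i.val + j.val + 1 = 1 then (1 : L) else 0)).Local v)] [BorelSpace ((cmDatum L 2 (Matrix.of fun i j : Fin 2 => if i.val + j.val + 1 = 2 then (1 : L) else 0)).Local v × (cmDatum L 1 (Matrix.of fun i j : Fin 1 => if i.val + j.val + 1 = 1 then (1 : L) else 0)).Local v)] (ν : Measure ((cmDatum L 2 (Matrix.of fun i j : Fin 2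 => if i.val + j.val + 1 = 2 then (1 : L) else 0)).Local v × (cmDatum L 1 (Matrix.of fun i j : Fin 1 => if i.val + j.val + 1 = 1 then (1 : L) else 0)).Local v)) [ν.IsHaarMeasure] [ν.IsMulRightInvariant]

/-! ## §1 ONE orbital integral in standard position -/

-- `L_w`-sized statement: elaboration budget only (no search)
set_option maxHeartbeats 1600000 in
include he in
/-- **ONE ORBITAL INTEGRAL AS A FINITE SHELL SUM WITH THE WEIGHTS `2·q_v^m`** (★ p844070 with its five hypotheses discharged).  Data: the root `x₀ = 𝒪_v²` and its
stabiliser `K` through `ρ_w ∘ E₂` (`K × U(Φ₁)_v` open), an Eisenstein datum `(τ_E; u₀, v₀)` with integral basis (`hE`), the shell element `ũ_η = diag(η, (σ_w η)⁻¹) ∈ U_w`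
(`η` a uniformiser of `L_w`), `x ∈ H_v` with PROPER orbit map whose `E₂`-descent `diag(1,α)·E₂(x.1)·diag(1,α)⁻¹ = s·ι(γ)` lies in the torus `γ = (a, b v₀; b, a + b u₀)`,
and `f` locally constant with compact support.  THEN for all `M₁` beyond a bound:
`∫_{H_v} f(y x y⁻¹) dν(y) = Σ_{m ≤ M₁} (2·q_v^m) • ∫_{K × U(Φ₁)_v} f(k⁻¹ ((E₂⁻¹(ũ_η⁻¹ ^ m), 1)⁻¹ x (E₂⁻¹(ũ_η⁻¹ ^ m), 1)) k) dν(k)`.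
[cite: LabesseLanglands1979, §2 p. 8] [cite: Rogawski1990, §4.9 p. 54] [cite: Kottwitz1986, §3] -/
theorem exists_integral_conj_eq_sum_shells_of_descent
    (K : Subgroup ((cmDatum L 2 (Matrix.of fun i j : Fin 2 => if i.val + j.val + 1 = 2 then (1 : L) else 0)).Local v))
    (E₂ : (cmDatum L 2 (Matrix.of fun i j : Fin 2 => if i.val + j.val + 1 = 2 then (1 : L) else 0)).Local v ≃ₜ* ↥(unitaryGroupOfForm (galAdicCompletionMap (L := L) (IsCMField.complexConj L) hw) (placeForm (Matrix.of fun i j : Fin 2 => if i.val + j.val + 1 = 2 then (1 : L) else 0) w.1)))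
    (x₀ : {M : Submodule 𝒪[v.adicCompletion ↥(maximalRealSubfield L)] (Fin 2 → v.adicCompletion ↥(maximalRealSubfield L)) // IsSpecialLattice (RingHom.id _) ϖF !![(0 : v.adicCompletion ↥(maximalRealSubfield L)), 1; -1, 0] M}) (hx₀ : x₀.1 = latt (1 : Matrix (Fin 2) (Fin 2) (v.adicCompletion ↥(maximalRealSubfield L))))
    (hK : ∀ g, g ∈ K ↔ rhoVertexActPlace L v w hw hα hα0 hϖF (E₂ g) x₀ = x₀) (hKo : IsOpen ((((K.prod (⊤ : Subgroup ((cmDatum L 1 (Matrix.of fun i j : Fin 1 => if i.val + j.val + 1 = 1 then (1 : L) else 0)).Local v))) : Subgroup ((cmDatum L 2 (Matrix.of fun i j : Fin 2 => if i.val + j.val + 1 = 2 then (1 : L) else 0)).Local v × (cmDatum L 1 (Matrix.of fun i j : Fin 1 => if i.val + j.val + 1 = 1 then (1 : L) else 0)).Local v))) : Set ((cmDatum L 2 (Matrix.of fun i j : Fin 2 => if i.val + j.val + 1 = 2 then (1 : L) else 0)).Local v × (cmDatum L 1 (Matrix.of fun i j : Fin 1 => if i.val + j.val + 1 = 1 then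 (1 : L) else 0)).Local v)))
    {u₀ v₀ : v.adicCompletion ↥(maximalRealSubfield L)} (hu : u₀ ∈ 𝒪[v.adicCompletion ↥(maximalRealSubfield L)]) (hu1 : valuation (v.adicCompletion ↥(maximalRealSubfield L)) u₀ < 1) (hv1 : valuation (v.adicCompletion ↥(maximalRealSubfield L)) v₀ = valuation (v.adicCompletion ↥(maximalRealSubfield L)) ϖF)
    (hE : ∀ p q : v.adicCompletion ↥(maximalRealSubfield L), valuation (v.adicCompletion ↥(maximalRealSubfield L)) (p ^ 2 + p * q * u₀ - q ^ 2 * v₀) ≤ 1 → p ∈ 𝒪[v.adicCompletion ↥(maximalRealSubfield L)] ∧ q ∈ 𝒪[v.adicCompletion ↥(maximalRealSubfield L)])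
    {τE : w.1.adicCompletion L} (hτ : τE * τE = toPlace v w u₀ * τE + toPlace v w v₀) (hστ : galAdicCompletionMap (L := L) (IsCMField.complexConj L) hw τE = toPlace v w u₀ - τE)
    (η : (w.1.adicCompletion L)ˣ) (hη : Valued.v (η : w.1.adicCompletion L) = WithZero.exp (-1 : ℤ))
    (uη : ↥(unitaryGroupOfForm (galAdicCompletionMap (L := L) (IsCMField.complexConj L) hw) (placeForm (Matrix.of fun i j : Fin 2 => if i.val + j.val + 1 = 2 then (1 : L) else 0) w.1))) (huη : (((uη : ↥(unitaryGroupOfForm (galAdicCompletionMap (L := L) (IsCMField.complexConj L) hw) (placeForm (Matrix.of fun i j : Fin 2 => if i.val + j.val + 1 = 2 then (1 : L) else 0) w.1))) : GL (Fin 2) (w.1.adicCompletion L)) : Matrix (Fin 2) (Fin 2) (w.1.adicCompletion L)) = Matrix.diagonal ![(η : w.1.adicCompletion L), (galAdicCompletionMap (L := L) (IsCMField.complexConj L) hw (η : w.1.adicCompletion L))⁻¹])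
    (x : ((cmDatum L 2 (Matrix.of fun i j : Fin 2 => if i.val + j.val + 1 = 2 then (1 : L) else 0)).Local v × (cmDatum L 1 (Matrix.of fun i j : Fin 1 => if i.val + j.val + 1 = 1 then (1 : L) else 0)).Local v)) (hprop : ∀ Q : Set ((cmDatum L 2 (Matrix.of fun i j : Fin 2 => if i.val + j.val + 1 = 2 then (1 : L) else 0)).Local v × (cmDatum L 1 (Matrix.of fun i j : Fin 1 => if i.val + j.val + 1 = 1 then (1 : L) else 0)).Local v), IsCompact Q → IsCompact {h : ((cmDatum L 2 (Matrix.of fun i j : Fin 2 => if i.val + j.val + 1 = 2 then (1 : L) else 0)).Local v × (cmDatum L 1 (Matrix.of fun i j : Fin 1 => if i.val + j.val + 1 = 1 then (1 : L) else 0)).Local v) | h * x * h⁻¹ ∈ Q})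
    {s : w.1.adicCompletion L} {γ : GL (Fin 2) (v.adicCompletion ↥(maximalRealSubfield L))} {a b : v.adicCompletion ↥(maximalRealSubfield L)} (hγ : (γ : Matrix (Fin 2) (Fin 2) (v.adicCompletion ↥(maximalRealSubfield L))) = !![a, b * v₀; b, a + b * u₀])
    (hsx : Matrix.diagonal ![1, α] * (((E₂ x.1 : ↥(unitaryGroupOfForm (galAdicCompletionMap (L := L) (IsCMField.complexConj L) hw) (placeForm (Matrix.of fun i j : Fin 2 => if i.val + j.val + 1 = 2 then (1 : L) else 0) w.1))) : GL (Fin 2) (w.1.adicCompletion L)) : Matrix (Fin 2) (Fin 2) (w.1.adicCompletion L)) * Matrix.diagonal ![1, α⁻¹] = s • (γ : Matrix (Fin 2) (Fin 2) (v.adicCompletion ↥(maximalRealSubfield L))).map (toPlace v w))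
    (f : ((cmDatum L 2 (Matrix.of fun i j : Fin 2 => if i.val + j.val + 1 = 2 then (1 : L) else 0)).Local v × (cmDatum L 1 (Matrix.of fun i j : Fin 1 => if i.val + j.val + 1 = 1 then (1 : L) else 0)).Local v) → ℂ) (hf : IsLocSmooth f) :
    ∃ B : ℕ, ∀ M₁ : ℕ, B ≤ M₁ →
      ∫ y, f (y * x * y⁻¹) ∂ν = ∑ m ∈ Finset.range (M₁ + 1), (2 * Nat.card (IsLocalRing.ResidueField 𝒪[v.adicCompletion ↥(maximalRealSubfield L)]) ^ m) • (∫ k in ((((K.prod (⊤ : Subgroup ((cmDatum L 1 (Matrix.of fun i j : Fin 1 => if i.val + j.val + 1 = 1 then (1 : L) else 0)).Local v))) : Subgroup ((cmDatum L 2 (Matrix.of fun i j : Fin 2 => if i.val + j.val + 1 = 2 then (1 : L) else 0)).Local v × (cmDatum L 1 (Matrix.of fun i j : Fin 1 => if i.val + j.val + 1 = 1 then (1 : L) else 0)).Local v))) : Set ((cmDatum L 2 (Matrix.of fun i j : Fin 2 => if i.val + j.val + 1 = 2 then (1 : L) else 0)).Local v × (cmDatum L 1 (Matrix.of fun i j :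 Fin 1 => if i.val + j.val + 1 = 1 then (1 : L) else 0)).Local v)), f (k⁻¹ * (((E₂.symm (uη⁻¹ ^ (m)), (1 : (cmDatum L 1 (Matrix.of fun i j : Fin 1 => if i.val + j.val + 1 = 1 then (1 : L) else 0)).Local v)) : ((cmDatum L 2 (Matrix.of fun i j : Fin 2 => if i.val + j.val + 1 = 2 then (1 : L) else 0)).Local v × (cmDatum L 1 (Matrix.of fun i j : Fin 1 => if i.val + j.val + 1 = 1 then (1 : L) else 0)).Local v))⁻¹ * (x) * (E₂.symm (uη⁻¹ ^ (m)), 1)) * k) ∂ν) := by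
  classical
  haveI : IsDiscreteValuationRing 𝒪[v.adicCompletion ↥(maximalRealSubfield L)] := isDiscreteValuationRing_integer_of_compatible hϖF
  haveI : Finite (IsLocalRing.ResidueField 𝒪[v.adicCompletion ↥(maximalRealSubfield L)]) := finite_residueField_integer_adicCompletion L v
  have hϖ : IsUniformizingElement ϖF := isUniformizingElement_of_v_eq hϖF
  have hϖ0 : ϖF ≠ 0 := hϖ.ne_zero
  -- the shell representatives `r m = diag(1, ϖ^m)` and the companion `γτ = (0, v₀; 1, u₀)`
  obtain ⟨r, hr⟩ := exists_shellRep_fn (F := v.adicCompletion ↥(maximalRealSubfield L)) hϖ0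
  have hv0 : v₀ ≠ 0 := by
    intro h0
    rw [h0, map_zero] at hv1
    exact hϖ0 ((map_eq_zero _).1 hv1.symm)
  have hdetτ : (!![(0 : v.adicCompletion ↥(maximalRealSubfield L)), v₀; 1, u₀]).det ≠ 0 := by
    rw [Matrix.det_fin_two_of]; simp [hv0]
  obtain ⟨γτ, hγτ⟩ : ∃ γτ : GL (Fin 2) (v.adicCompletion ↥(maximalRealSubfield L)), (γτ : Matrix (Fin 2) (Fin 2) (v.adicCompletion ↥(maximalRealSubfield L))) = !![0, v₀; 1, u₀] :=
    ⟨Matrix.GeneralLinearGroup.mk'' _ (isUnit_iff_ne_zero.2 hdetτ), rfl⟩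
  have hv : v₀ ∈ 𝒪[v.adicCompletion ↥(maximalRealSubfield L)] := by rw [Valuation.mem_integer_iff, hv1]; exact hϖ.valuation_le_one
  -- THE shell index of ★ III
  obtain ⟨dS, hd, hd'⟩ := exists_shellIndex hϖ hu hv hE x₀ hx₀
  -- the unitary shell representatives `ũ_η⁻¹ ^ m` realise `r m` on the tree
  have hrU : ∀ m : ℕ, rhoVertexActPlace L v w hw hα hα0 hϖF (uη⁻¹ ^ m) x₀ = glVertexAct hϖ (r m) x₀ := fun m =>
    rhoVertexActPlace_inv_pow_root_eq L v w hw hα hα0 hϖF he η hη huη (hr m) x₀ hx₀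
  -- the GL₂-level shell decomposition about the torus of `γ`
  have hGL : ∀ y : {M : Submodule 𝒪[v.adicCompletion ↥(maximalRealSubfield L)] (Fin 2 → v.adicCompletion ↥(maximalRealSubfield L)) // IsSpecialLattice (RingHom.id _) ϖF !![(0 : v.adicCompletion ↥(maximalRealSubfield L)), 1; -1, 0] M}, ∃ (t : GL (Fin 2) (v.adicCompletion ↥(maximalRealSubfield L))) (c' e' : v.adicCompletion ↥(maximalRealSubfield L)), (t : Matrix (Fin 2) (Fin 2) (v.adicCompletion ↥(maximalRealSubfield L))) = !![c', e' * v₀; e', c' + e' * u₀] ∧ t * γ = γ * t ∧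
      glVertexAct hϖ (t * r (dS y)) x₀ = y := by
    intro y
    obtain ⟨t, gm, c, e, ht, hgm, hy⟩ := hd y
    have hgm' : gm = r (dS y) := Units.ext (by rw [hgm, hr])
    exact ⟨t, c, e, ht, (quadTorus_mul_comm hγ ht).symm, by rw [← hgm', ← hy]⟩
  -- the support bound: `y ↦ d(ρ_w(E₂ y.1)·x₀)` is locally constant, hence bounded on the compact `{y | y⁻¹ x y ∈ tsupport f}`
  have hScpt : IsCompact {y : ((cmDatum L 2 (Matrix.of fun i j : Fin 2 => if i.val + j.val + 1 = 2 then (1 : L) else 0)).Local v × (cmDatum L 1 (Matrix.of fun i j : Fin 1 => if i.val + j.val + 1 = 1 then (1 : L) else 0)).Local v) | y⁻¹ * x * y ∈ tsupport f} := by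
    have h1 : {y : ((cmDatum L 2 (Matrix.of fun i j : Fin 2 => if i.val + j.val + 1 = 2 then (1 : L) else 0)).Local v × (cmDatum L 1 (Matrix.of fun i j : Fin 1 => if i.val + j.val + 1 = 1 then (1 : L) else 0)).Local v) | y⁻¹ * x * y ∈ tsupport f} = {h : ((cmDatum L 2 (Matrix.of fun i j : Fin 2 => if i.val + j.val + 1 = 2 then (1 : L) else 0)).Local v × (cmDatum L 1 (Matrix.of fun i j : Fin 1 => if i.val + j.val + 1 = 1 then (1 : L) else 0)).Local v) | h * x * h⁻¹ ∈ tsupport f}⁻¹ := by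
      ext y
      simp only [Set.mem_setOf_eq, Set.mem_inv, inv_inv]
    rw [h1]
    exact (hprop _ hf.2.isCompact).inv
  have hΦ : IsLocallyConstant (fun y : ((cmDatum L 2 (Matrix.of fun i j : Fin 2 => if i.val + j.val + 1 = 2 then (1 : L) else 0)).Local v × (cmDatum L 1 (Matrix.of fun i j : Fin 1 => if i.val + j.val + 1 = 1 then (1 : L) else 0)).Local v) => dS (rhoVertexActPlace L v w hw hα hα0 hϖF (E₂ y.1) x₀)) := by
    refine (IsLocallyConstant.iff_exists_open _).2 fun y => ⟨(fun k : ((cmDatum L 2 (Matrix.of fun i j : Fin 2 => if i.val + j.val + 1 = 2 then (1 : L) else 0)).Local v × (cmDatum L 1 (Matrix.of fun i j : Fin 1 => if i.val + j.val + 1 = 1 then (1 : L) else 0)).Local v) => y * k) '' ((((K.prod (⊤ : Subgroup ((cmDatum L 1 (Matrix.of fun i j : Fin 1 => if i.val + j.val + 1 = 1 then (1 : L) else 0)).Local v))) : Subgroup ((cmDatum L 2 (Matrix.of fun i j : Fin 2 => if i.val + j.val + 1 = 2 then (1 : L) else 0)).Local v × (cmDatum L 1 (Matrix.of fun i j : Fin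 1 => if i.val + j.val + 1 = 1 then (1 : L) else 0)).Local v))) : Set ((cmDatum L 2 (Matrix.of fun i j : Fin 2 => if i.val + j.val + 1 = 2 then (1 : L) else 0)).Local v × (cmDatum L 1 (Matrix.of fun i j : Fin 1 => if i.val + j.val + 1 = 1 then (1 : L) else 0)).Local v)), isOpenMap_mul_left y _ hKo, ⟨1, Subgroup.one_mem _, mul_one y⟩, ?_⟩
    rintro _ ⟨k, hk, rfl⟩
    have hk1 : k.1 ∈ K := (Subgroup.mem_prod.1 hk).1
    show dS (rhoVertexActPlace L v w hw hα hα0 hϖF (E₂ (y * k).1) x₀) = dS (rhoVertexActPlace L v w hw hα hα0 hϖF (E₂ y.1) x₀)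
    rw [Prod.fst_mul, map_mul, rhoVertexActPlace_mul, (hK k.1).1 hk1]
  have hfin : ((fun y : ((cmDatum L 2 (Matrix.of fun i j : Fin 2 => if i.val + j.val + 1 = 2 then (1 : L) else 0)).Local v × (cmDatum L 1 (Matrix.of fun i j : Fin 1 => if i.val + j.val + 1 = 1 then (1 : L) else 0)).Local v) => dS (rhoVertexActPlace L v w hw hα hα0 hϖF (E₂ y.1) x₀)) '' {y : ((cmDatum L 2 (Matrix.of fun i j : Fin 2 => if i.val + j.val + 1 = 2 then (1 : L) else 0)).Local v × (cmDatum L 1 (Matrix.of fun i j : Fin 1 => if i.val + j.val + 1 = 1 then (1 : L) else 0)).Local v) | y⁻¹ * x * y ∈ tsupport f}).Finite :=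
    (hScpt.image hΦ.continuous).finite_of_discrete
  obtain ⟨B, hB⟩ := hfin.bddAbove
  refine ⟨B, fun M₁ hM₁ => ?_⟩
  -- the five hypotheses of ★ p844070 at `SV := {M | d M ≤ M₁}`, `s := range (M₁ + 1)`, `rU m := ũ_η⁻¹ ^ m`
  have hSV : {M : {M : Submodule 𝒪[v.adicCompletion ↥(maximalRealSubfield L)] (Fin 2 → v.adicCompletion ↥(maximalRealSubfield L)) // IsSpecialLattice (RingHom.id _) ϖF !![(0 : v.adicCompletion ↥(maximalRealSubfield L)), 1; -1, 0] M} | dS M ≤ M₁}.Finite := finite_setOf_shellIndex_le_of_eisenstein hϖ hu hu1 hv1 hγτ hr x₀ hx₀ hd hd' M₁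
  have hs : ∀ M ∈ {M : {M : Submodule 𝒪[v.adicCompletion ↥(maximalRealSubfield L)] (Fin 2 → v.adicCompletion ↥(maximalRealSubfield L)) // IsSpecialLattice (RingHom.id _) ϖF !![(0 : v.adicCompletion ↥(maximalRealSubfield L)), 1; -1, 0] M} | dS M ≤ M₁}, dS M ∈ Finset.range (M₁ + 1) := shellIndex_mem_range_of_mem dS M₁
  have hsupp : ∀ y : ((cmDatum L 2 (Matrix.of fun i j : Fin 2 => if i.val + j.val + 1 = 2 then (1 : L) else 0)).Local v × (cmDatum L 1 (Matrix.of fun i j : Fin 1 => if i.val + j.val + 1 = 1 then (1 : L) else 0)).Local v), f (y⁻¹ * x * y) ≠ 0 → rhoVertexActPlace L v w hw hα hα0 hϖF (E₂ y.1) x₀ ∈ {M : {M : Submodule 𝒪[v.adicCompletion ↥(maximalRealSubfield L)] (Fin 2 → v.adicCompletion ↥(maximalRealSubfield L)) // IsSpecialLattice (RingHom.id _) ϖF !![(0 : v.adicCompletion ↥(maximalRealSubfield L)), 1; -1, 0] M} | dS M ≤ M₁} := by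
    intro y hy
    have hyS : y ∈ {y : ((cmDatum L 2 (Matrix.of fun i j : Fin 2 => if i.val + j.val + 1 = 2 then (1 : L) else 0)).Local v × (cmDatum L 1 (Matrix.of fun i j : Fin 1 => if i.val + j.val + 1 = 1 then (1 : L) else 0)).Local v) | y⁻¹ * x * y ∈ tsupport f} := subset_tsupport _ (Function.mem_support.2 hy)
    exact le_trans (hB ⟨y, hyS, rfl⟩) hM₁
  have hshellU : ∀ M ∈ {M : {M : Submodule 𝒪[v.adicCompletion ↥(maximalRealSubfield L)] (Fin 2 → v.adicCompletion ↥(maximalRealSubfield L)) // IsSpecialLattice (RingHom.id _) ϖF !![(0 : v.adicCompletion ↥(maximalRealSubfield L)), 1; -1, 0] M} | dS M ≤ M₁}, ∃ tU : ↥(unitaryGroupOfForm (galAdicCompletionMap (L := L) (IsCMField.complexConj L) hw) (placeForm (Matrix.of fun i j : Fin 2 => if i.val + j.val + 1 = 2 then (1 : L) else 0) w.1)), tU * E₂ x.1 = E₂ x.1 * tU ∧ rhoVertexActPlace L v w hw hα hα0 hϖF (tU * (fun m : ℕ => uη⁻¹ ^ m) (dS M)) x₀ = M :=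
    fun M _ => exists_comm_rhoVertexActPlace_mul_eq L v w hw hα hα0 hϖF hτ hστ hsx x₀ (rU := fun m : ℕ => uη⁻¹ ^ m) hrU hGL M
  have hF : Integrable (fun y : ((cmDatum L 2 (Matrix.of fun i j : Fin 2 => if i.val + j.val + 1 = 2 then (1 : L) else 0)).Local v × (cmDatum L 1 (Matrix.of fun i j : Fin 1 => if i.val + j.val + 1 = 1 then (1 : L) else 0)).Local v) => f (y⁻¹ * x * y)) ν := by
    have hc : Continuous fun y : ((cmDatum L 2 (Matrix.of fun i j : Fin 2 => if i.val + j.val + 1 = 2 then (1 : L) else 0)).Local v × (cmDatum L 1 (Matrix.of fun i j : Fin 1 => if i.val + j.val + 1 = 1 then (1 : L) else 0)).Local v) => f (y⁻¹ * x * y) :=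
      hf.1.continuous.comp ((continuous_inv.mul continuous_const).mul continuous_id)
    have heq : (fun y : ((cmDatum L 2 (Matrix.of fun i j : Fin 2 => if i.val + j.val + 1 = 2 then (1 : L) else 0)).Local v × (cmDatum L 1 (Matrix.of fun i j : Fin 1 => if i.val + j.val + 1 = 1 then (1 : L) else 0)).Local v) => f (y⁻¹ * x * y)) = (fun h : ((cmDatum L 2 (Matrix.of fun i j : Fin 2 => if i.val + j.val + 1 = 2 then (1 : L) else 0)).Local v × (cmDatum L 1 (Matrix.of fun i j : Fin 1 => if i.val + j.val + 1 = 1 then (1 : L) else 0)).Local v) => f (h * x * h⁻¹)) ∘ (Homeomorph.inv ((cmDatum L 2 (Matrix.of fun i j : Fin 2 => if i.val + j.val + 1 = 2 then (1 : L) else 0)).Local v × (cmDatum L 1 (Matrix.of fun i j : Fin 1 => if i.val + j.val + 1 = 1 then (1 : L) else 0)).Local v)) := by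
      funext y
      simp only [Function.comp_apply, Homeomorph.coe_inv, inv_inv]
    have hcs : HasCompactSupport fun y : ((cmDatum L 2 (Matrix.of fun i j : Fin 2 => if i.val + j.val + 1 = 2 then (1 : L) else 0)).Local v × (cmDatum L 1 (Matrix.of fun i j : Fin 1 => if i.val + j.val + 1 = 1 then (1 : L) else 0)).Local v) => f (y⁻¹ * x * y) := by
      rw [heq]
      exact (hasCompactSupport_comp_conj x hf.2 hprop).comp_homeomorph _
    exact hc.integrable_of_hasCompactSupport hcs
  rw [integral_conj_eq_sum_ncard_shell_smul_onePlace L v w hw hα hα0 hϖF he ν K E₂ x₀ hx₀ hK hKo x f hF hSV hsupp dS (fun m : ℕ => uη⁻¹ ^ m)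
    (Finset.range (M₁ + 1)) hshellU hs]
  refine Finset.sum_congr rfl fun m hm => ?_
  rw [ncard_sep_setOf_shellIndex_le_eq_two_mul_pow_of_eisenstein hϖ hu hu1 hv1 hγτ hr x₀ hx₀ hd hd' M₁ m (Nat.le_of_lt_succ (Finset.mem_range.1 hm))]

end Place

/-! ## §2 The `u`-rescaled Eisenstein datum (for the partner `e = Ad(diag(1,u))`) -/

/-- Conjugating by `diag(1, ι u_F)` commutes with the descent conjugation by `diag(1, α)`: if `diag(1,α)·X·diag(1,α)⁻¹ = s·ι(g)` then
`diag(1,α)·(diag(1,ι u_F)·X·diag(1,(ι u_F)⁻¹))·diag(1,α)⁻¹ = s·ι(diag(1,u_F)·g·diag(1,u_F⁻¹))`. [cite: Serre1980Trees, Ch. II §1.3] -/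
theorem descent_conj_diagonal_eq {F E : Type*} [Field F] [Field E] (ι : F →+* E) (α : E) (uF : F)
    {X : Matrix (Fin 2) (Fin 2) E} {s : E} {g : Matrix (Fin 2) (Fin 2) F}
    (hX : Matrix.diagonal ![1, α] * X * Matrix.diagonal ![1, α⁻¹] = s • g.map ι) :
    Matrix.diagonal ![1, α] * (Matrix.diagonal ![1, ι uF] * X * Matrix.diagonal ![1, (ι uF)⁻¹]) * Matrix.diagonal ![1, α⁻¹] =
      s • (Matrix.diagonal ![1, uF] * g * Matrix.diagonal ![1, uF⁻¹]).map ι := by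
  have hd1 : (Matrix.diagonal ![(1 : F), uF]).map ι = Matrix.diagonal ![1, ι uF] := by
    rw [Matrix.diagonal_map (map_zero ι)]
    congr 1
    funext i
    fin_cases i <;> simp
  have hd2 : (Matrix.diagonal ![(1 : F), uF⁻¹]).map ι = Matrix.diagonal ![1, (ι uF)⁻¹] := by
    rw [Matrix.diagonal_map (map_zero ι)]
    congr 1
    funext i
    fin_cases i <;> simp
  have hc1 : Matrix.diagonal ![(1 : E), α] * Matrix.diagonal ![1, ι uF] = Matrix.diagonal ![1, ι uF] * Matrix.diagonal ![(1 : E), α] := by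
    rw [Matrix.diagonal_mul_diagonal, Matrix.diagonal_mul_diagonal]
    congr 1
    funext i
    exact mul_comm _ _
  have hc2 : Matrix.diagonal ![1, (ι uF)⁻¹] * Matrix.diagonal ![(1 : E), α⁻¹] = Matrix.diagonal ![(1 : E), α⁻¹] * Matrix.diagonal ![1, (ι uF)⁻¹] := by
    rw [Matrix.diagonal_mul_diagonal, Matrix.diagonal_mul_diagonal]
    congr 1
    funext i
    exact mul_comm _ _
  calc Matrix.diagonal ![1, α] * (Matrix.diagonal ![1, ι uF] * X * Matrix.diagonal ![1, (ι uF)⁻¹]) * Matrix.diagonal ![1, α⁻¹]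
      = (Matrix.diagonal ![1, α] * Matrix.diagonal ![1, ι uF]) * X * (Matrix.diagonal ![1, (ι uF)⁻¹] * Matrix.diagonal ![1, α⁻¹]) := by
        simp only [Matrix.mul_assoc]
    _ = Matrix.diagonal ![1, ι uF] * (Matrix.diagonal ![1, α] * X * Matrix.diagonal ![1, α⁻¹]) * Matrix.diagonal ![1, (ι uF)⁻¹] := by
        rw [hc1, hc2]; simp only [Matrix.mul_assoc]
    _ = Matrix.diagonal ![1, ι uF] * (s • g.map ι) * Matrix.diagonal ![1, (ι uF)⁻¹] := by rw [hX]
    _ = s • ((Matrix.diagonal ![(1 : F), uF]).map ι * g.map ι * (Matrix.diagonal ![(1 : F), uF⁻¹]).map ι) := by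
        rw [hd1, hd2, Matrix.mul_smul, Matrix.smul_mul]
    _ = s • (Matrix.diagonal ![1, uF] * g * Matrix.diagonal ![1, uF⁻¹]).map ι := by rw [Matrix.map_mul, Matrix.map_mul]

/-- The regular-representation matrix of `a + bτ` conjugated by `diag(1, u_F)` is the regular-representation matrix of the RESCALED datum
`(u₀∕u_F, v₀∕u_F²)` at `(a, u_F b)`. [cite: LabesseLanglands1979, §2 p. 7] -/
theorem diagonal_mul_regRep_mul_diagonal_inv {F : Type*} [Field F] {uF : F} (huF : uF ≠ 0) (a b u₀ v₀ : F) :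
    Matrix.diagonal ![1, uF] * !![a, b * v₀; b, a + b * u₀] * Matrix.diagonal ![1, uF⁻¹] =
      !![a, (uF * b) * (v₀ * uF⁻¹ ^ 2); uF * b, a + (uF * b) * (u₀ * uF⁻¹)] := by
  ext i j
  fin_cases i <;> fin_cases j <;> simp [Matrix.diagonal_mul, Matrix.mul_diagonal] <;> field_simp

section Rescale

variable (L : Type) [Field L] [NumberField L] (v : HeightOneSpectrum (𝓞 ↥(maximalRealSubfield L))) {ϖF : v.adicCompletion ↥(maximalRealSubfield L)}

/-- **The rescaled datum is again Eisenstein**: for a unit `u_F` (`valuation u_F = 1`), `(u₀∕u_F, v₀∕u_F²)` satisfies the three F-side hypotheses and the integral-basis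
binder `hE` whenever `(u₀, v₀)` does. [cite: Serre1979, Ch. I §6 Prop. 18] [cite: LabesseLanglands1979, §2 p. 7] -/
theorem eisenstein_rescale {uF u₀ v₀ : v.adicCompletion ↥(maximalRealSubfield L)} (huF : valuation (v.adicCompletion ↥(maximalRealSubfield L)) uF = 1)
    (hu : u₀ ∈ 𝒪[v.adicCompletion ↥(maximalRealSubfield L)]) (hu1 : valuation (v.adicCompletion ↥(maximalRealSubfield L)) u₀ < 1) (hv1 : valuation (v.adicCompletion ↥(maximalRealSubfield L)) v₀ = valuation (v.adicCompletion ↥(maximalRealSubfield L)) ϖF)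
    (hE : ∀ p q : v.adicCompletion ↥(maximalRealSubfield L), valuation (v.adicCompletion ↥(maximalRealSubfield L)) (p ^ 2 + p * q * u₀ - q ^ 2 * v₀) ≤ 1 → p ∈ 𝒪[v.adicCompletion ↥(maximalRealSubfield L)] ∧ q ∈ 𝒪[v.adicCompletion ↥(maximalRealSubfield L)]) :
    u₀ * uF⁻¹ ∈ 𝒪[v.adicCompletion ↥(maximalRealSubfield L)] ∧ valuation (v.adicCompletion ↥(maximalRealSubfield L)) (u₀ * uF⁻¹) < 1 ∧ valuation (v.adicCompletion ↥(maximalRealSubfield L)) (v₀ * uF⁻¹ ^ 2) = valuation (v.adicCompletion ↥(maximalRealSubfield L)) ϖF ∧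
      (∀ p q : v.adicCompletion ↥(maximalRealSubfield L), valuation (v.adicCompletion ↥(maximalRealSubfield L)) (p ^ 2 + p * q * (u₀ * uF⁻¹) - q ^ 2 * (v₀ * uF⁻¹ ^ 2)) ≤ 1 → p ∈ 𝒪[v.adicCompletion ↥(maximalRealSubfield L)] ∧ q ∈ 𝒪[v.adicCompletion ↥(maximalRealSubfield L)]) := by
  have huF0 : uF ≠ 0 := fun h0 => by rw [h0, map_zero] at huF; exact zero_ne_one huF
  have hvinv : valuation (v.adicCompletion ↥(maximalRealSubfield L)) uF⁻¹ = 1 := by rw [map_inv₀, huF, inv_one]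
  have huFO : uF ∈ 𝒪[v.adicCompletion ↥(maximalRealSubfield L)] := by rw [Valuation.mem_integer_iff, huF]
  refine ⟨?_, ?_, ?_, fun p q h => ?_⟩
  · rw [Valuation.mem_integer_iff, map_mul, hvinv, mul_one]; exact hu
  · rw [map_mul, hvinv, mul_one]; exact hu1
  · rw [map_mul, map_pow, hvinv, one_pow, mul_one]; exact hv1
  · have hid : p ^ 2 + p * q * (u₀ * uF⁻¹) - q ^ 2 * (v₀ * uF⁻¹ ^ 2) = p ^ 2 + p * (q * uF⁻¹) * u₀ - (q * uF⁻¹) ^ 2 * v₀ := by ring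
    rw [hid] at h
    obtain ⟨hp, hq⟩ := hE p (q * uF⁻¹) h
    refine ⟨hp, ?_⟩
    have hq' : q = q * uF⁻¹ * uF := by field_simp
    rw [hq']
    exact mul_mem hq huFO

variable [IsCMField L] (w : PlacesOver L v) (hw : IsCMField.complexConj L • w.1 = w.1)

include hw in
/-- **The rescaled quadratic datum**: with `τ' := τ_E · (ι u_F)⁻¹`, `τ'² = ι(u₀∕u_F) τ' + ι(v₀∕u_F²)` and `σ_w τ' = ι(u₀∕u_F) − τ'`. [cite: LabesseLanglands1979, §2 p. 7] -/
theorem quadDatum_rescale {uF u₀ v₀ : v.adicCompletion ↥(maximalRealSubfield L)} (huF0 : uF ≠ 0) {τE : w.1.adicCompletion L}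
    (hτ : τE * τE = toPlace v w u₀ * τE + toPlace v w v₀) (hστ : galAdicCompletionMap (L := L) (IsCMField.complexConj L) hw τE = toPlace v w u₀ - τE) :
    (τE * (toPlace v w uF)⁻¹) * (τE * (toPlace v w uF)⁻¹) = toPlace v w (u₀ * uF⁻¹) * (τE * (toPlace v w uF)⁻¹) + toPlace v w (v₀ * uF⁻¹ ^ 2) ∧
      galAdicCompletionMap (L := L) (IsCMField.complexConj L) hw (τE * (toPlace v w uF)⁻¹) = toPlace v w (u₀ * uF⁻¹) - τE * (toPlace v w uF)⁻¹ := by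
  have hι0 : toPlace v w uF ≠ 0 := by rw [Ne, map_eq_zero_iff _ (toPlace v w).injective]; exact huF0
  refine ⟨?_, ?_⟩
  · rw [map_mul, map_inv₀, map_mul, map_pow, map_inv₀]
    linear_combination ((toPlace v w uF)⁻¹ * (toPlace v w uF)⁻¹) * hτ
  · rw [map_mul, map_inv₀, galAdicCompletionMap_toPlace (IsCMField.complexConj L) w w hw, hστ, map_mul, map_inv₀]
    ring

end Rescale

section Main

variable (L : Type) [Field L] [NumberField L] [IsCMField L] (v : HeightOneSpectrum (𝓞 ↥(maximalRealSubfield L)))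
  (w : PlacesOver L v) (hw : IsCMField.complexConj L • w.1 = w.1)
  {α : w.1.adicCompletion L} (hα : galAdicCompletionMap (L := L) (IsCMField.complexConj L) hw α = -α) (hα0 : α ≠ 0)
  {ϖF : v.adicCompletion ↥(maximalRealSubfield L)} (hϖF : Valued.v ϖF = WithZero.exp (-1 : ℤ))
  (he : v.asIdeal.ramificationIdx' w.1.asIdeal ≠ 1)
  [MeasurableSpace ((cmDatum L 2 (Matrix.of fun i j : Fin 2 => if i.val + j.val + 1 = 2 then (1 : L) else 0)).Local v × (cmDatum L 1 (Matrix.of fun i j : Fin 1 => if i.val + j.val + 1 = 1 then (1 : L) else 0)).Local v)] [BorelSpace ((cmDatum L 2 (Matrix.of fun i j : Fin 2 => if i.val + j.val + 1 = 2 then (1 : L) else 0)).Local v × (cmDatum L 1 (Matrix.of fun i j : Fin 1 => if i.val + j.val + 1 = 1 then (1 : L) else 0)).Local v)] (ν : Measure ((cmDatum L 2 (Matrix.of fun i j : Fin 2 => if i.val + j.val + 1 = 2 then (1 : L) else 0)).Local v × (cmDatum L 1 (Matrix.of fun i j : Fin 1 => if i.val + j.val + 1 = 1 then (1 : L) else 0)).Local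 v)) [ν.IsHaarMeasure] [ν.IsMulRightInvariant]

/-! ## §3a Standard position propagates along the torus -/

-- `L_w`-sized statement: elaboration budget only (no search)
set_option maxHeartbeats 1600000 in
omit [MeasurableSpace ((cmDatum L 2 (Matrix.of fun i j : Fin 2 => if i.val + j.val + 1 = 2 then (1 : L) else 0)).Local v × (cmDatum L 1 (Matrix.of fun i j : Fin 1 => if i.val + j.val + 1 = 1 then (1 : L) else 0)).Local v)] [BorelSpace ((cmDatum L 2 (Matrix.of fun i j : Fin 2 => if i.val + j.val + 1 = 2 then (1 : L) else 0)).Local v × (cmDatum L 1 (Matrix.of fun i j : Fin 1 => if i.val + j.val + 1 = 1 then (1 : L) else 0)).Local v)] in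
include hα hα0 in
/-- **STANDARD POSITION PROPAGATES ALONG THE TORUS** (the per-`t` consequence of the shared binder `hpos`, for (B6-V) to cite): if the `E₂`-descent of `t₀` is
`s₀ · ι(a₀ + b₀ τ)` with `b₀ ≠ 0` (a NON-SCALAR element of Labesse–Langlands' torus `{(a, b v₀; b, a + b u₀)}`), then the descent of EVERY `t ∈ Z(t₀)` is `s · ι(γ)` with `γ`
in the same torus: the descents commute (the scalars cancel, `ι` is injective), and the commutant of a non-scalar `a₀ + b₀ γ_τ` is `L⁺_v[γ_τ]`
(★ `exists_coe_eq_regRep_of_mem_centralizer_companion`). [cite: LabesseLanglands1979, §2 p. 7] [cite: Serre1980Trees, Ch. II §1.3] -/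
theorem forall_exists_descent_eq_smul_regRep_of_pos
    (E₂ : (cmDatum L 2 (Matrix.of fun i j : Fin 2 => if i.val + j.val + 1 = 2 then (1 : L) else 0)).Local v ≃ₜ* ↥(unitaryGroupOfForm (galAdicCompletionMap (L := L) (IsCMField.complexConj L) hw) (placeForm (Matrix.of fun i j : Fin 2 => if i.val + j.val + 1 = 2 then (1 : L) else 0) w.1))) (t₀ : ((cmDatum L 2 (Matrix.of fun i j : Fin 2 => if i.val + j.val + 1 = 2 then (1 : L) else 0)).Local v × (cmDatum L 1 (Matrix.of fun i j : Fin 1 => if i.val + j.val + 1 = 1 then (1 : L) else 0)).Local v)) {u₀ v₀ : v.adicCompletion ↥(maximalRealSubfield L)} (hv0 : v₀ ≠ 0)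
    (hpos : ∃ (s : w.1.adicCompletion L) (a b : v.adicCompletion ↥(maximalRealSubfield L)), b ≠ 0 ∧
      Matrix.diagonal ![1, α] * (((E₂ t₀.1 : ↥(unitaryGroupOfForm (galAdicCompletionMap (L := L) (IsCMField.complexConj L) hw) (placeForm (Matrix.of fun i j : Fin 2 => if i.val + j.val + 1 = 2 then (1 : L) else 0) w.1))) : GL (Fin 2) (w.1.adicCompletion L)) : Matrix (Fin 2) (Fin 2) (w.1.adicCompletion L)) * Matrix.diagonal ![1, α⁻¹] = s • (!![a, b * v₀; b, a + b * u₀]).map (toPlace v w)) :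
    ∀ t : ↥(Subgroup.centralizer ({t₀} : Set ((cmDatum L 2 (Matrix.of fun i j : Fin 2 => if i.val + j.val + 1 = 2 then (1 : L) else 0)).Local v × (cmDatum L 1 (Matrix.of fun i j : Fin 1 => if i.val + j.val + 1 = 1 then (1 : L) else 0)).Local v))), ∃ (s : w.1.adicCompletion L) (γ : GL (Fin 2) (v.adicCompletion ↥(maximalRealSubfield L))) (a b : v.adicCompletion ↥(maximalRealSubfield L)), (γ : Matrix (Fin 2) (Fin 2) (v.adicCompletion ↥(maximalRealSubfield L))) = !![a, b * v₀; b, a + b * u₀] ∧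
      Matrix.diagonal ![1, α] * (((E₂ (t : ((cmDatum L 2 (Matrix.of fun i j : Fin 2 => if i.val + j.val + 1 = 2 then (1 : L) else 0)).Local v × (cmDatum L 1 (Matrix.of fun i j : Fin 1 => if i.val + j.val + 1 = 1 then (1 : L) else 0)).Local v)).1 : ↥(unitaryGroupOfForm (galAdicCompletionMap (L := L) (IsCMField.complexConj L) hw) (placeForm (Matrix.of fun i j : Fin 2 => if i.val + j.val + 1 = 2 then (1 : L) else 0) w.1))) : GL (Fin 2) (w.1.adicCompletion L)) : Matrix (Fin 2) (Fin 2) (w.1.adicCompletion L)) * Matrix.diagonal ![1, α⁻¹] = s • (γ : Matrix (Fin 2) (Fin 2) (v.adicCompletion ↥(maximalRealSubfield L))).map (toPlace v w) := by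
  intro t
  obtain ⟨s₀, a₀, b₀, hb₀, h₀⟩ := hpos
  -- the descent of `E₂ (↑t).1`
  have hmem : ((E₂ (t : ((cmDatum L 2 (Matrix.of fun i j : Fin 2 => if i.val + j.val + 1 = 2 then (1 : L) else 0)).Local v × (cmDatum L 1 (Matrix.of fun i j : Fin 1 => if i.val + j.val + 1 = 1 then (1 : L) else 0)).Local v)).1 : ↥(unitaryGroupOfForm (galAdicCompletionMap (L := L) (IsCMField.complexConj L) hw) (placeForm (Matrix.of fun i j : Fin 2 => if i.val + j.val + 1 = 2 then (1 : L) else 0) w.1))) : GL (Fin 2) (w.1.adicCompletion L)) ∈ unitaryGroupOfForm (galAdicCompletionMap (L := L) (IsCMField.complexConj L) hw) !![(0 : w.1.adicCompletion L), 1; 1, 0] := by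
    rw [← unitaryGroupOfForm_placeForm_antidiagTwo_eq L v w (galAdicCompletionMap (L := L) (IsCMField.complexConj L) hw)]
    exact (E₂ (t : ((cmDatum L 2 (Matrix.of fun i j : Fin 2 => if i.val + j.val + 1 = 2 then (1 : L) else 0)).Local v × (cmDatum L 1 (Matrix.of fun i j : Fin 1 => if i.val + j.val + 1 = 1 then (1 : L) else 0)).Local v)).1).2
  obtain ⟨s, γ, hs0, hγd⟩ := descent_of_mem_unitaryGroupOfForm_antidiag L v w hw hα hα0 _ hmem
  -- the companion matrix of the datum as an element of `GL₂`
  have hdetτ : (!![(0 : v.adicCompletion ↥(maximalRealSubfield L)), v₀; 1, u₀]).det ≠ 0 := by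
    rw [Matrix.det_fin_two_of]; simp [hv0]
  obtain ⟨γτ, hγτ⟩ : ∃ γτ : GL (Fin 2) (v.adicCompletion ↥(maximalRealSubfield L)), (γτ : Matrix (Fin 2) (Fin 2) (v.adicCompletion ↥(maximalRealSubfield L))) = !![0, v₀; 1, u₀] :=
    ⟨Matrix.GeneralLinearGroup.mk'' _ (isUnit_iff_ne_zero.2 hdetτ), rfl⟩
  -- `↑t` and `t₀` commute, hence so do the two unitary matrices and their descents
  have hcomm : (t : ((cmDatum L 2 (Matrix.of fun i j : Fin 2 => if i.val + j.val + 1 = 2 then (1 : L) else 0)).Local v × (cmDatum L 1 (Matrix.of fun i j : Fin 1 => if i.val + j.val + 1 = 1 then (1 : L) else 0)).Local v)) * t₀ = t₀ * (t : ((cmDatum L 2 (Matrix.of fun i j : Fin 2 => if i.val + j.val + 1 = 2 then (1 : L) else 0)).Local v × (cmDatum L 1 (Matrix.of fun i j : Fin 1 => if i.val + j.val + 1 = 1 then (1 : L) else 0)).Local v)) := ((Subgroup.mem_centralizer_iff.1 t.2) t₀ (Set.mem_singleton t₀)).symm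
  have hXc : (((E₂ (t : ((cmDatum L 2 (Matrix.of fun i j : Fin 2 => if i.val + j.val + 1 = 2 then (1 : L) else 0)).Local v × (cmDatum L 1 (Matrix.of fun i j : Fin 1 => if i.val + j.val + 1 = 1 then (1 : L) else 0)).Local v)).1 : ↥(unitaryGroupOfForm (galAdicCompletionMap (L := L) (IsCMField.complexConj L) hw) (placeForm (Matrix.of fun i j : Fin 2 => if i.val + j.val + 1 = 2 then (1 : L) else 0) w.1))) : GL (Fin 2) (w.1.adicCompletion L)) : Matrix (Fin 2) (Fin 2) (w.1.adicCompletion L)) * (((E₂ t₀.1 : ↥(unitaryGroupOfForm (galAdicCompletionMap (L := L) (IsCMField.complexConj L) hw) (placeForm (Matrix.of fun i j : Fin 2 => if i.val + j.val + 1 = 2 then (1 : L) else 0) w.1))) : GL (Fin 2) (w.1.adicCompletion L)) : Matrix (Fin 2) (Fin 2) (w.1.adicCompletion L)) = (((E₂ t₀.1 : ↥(unitaryGroupOfForm (galAdicCompletionMap (L := L) (IsCMField.complexConj L) hw) (placeForm (Matrix.of fun i j : Fin 2 => if i.val + j.val + 1 = 2 then (1 : L) else 0) w.1))) : GL (Fin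 2) (w.1.adicCompletion L)) : Matrix (Fin 2) (Fin 2) (w.1.adicCompletion L)) * (((E₂ (t : ((cmDatum L 2 (Matrix.of fun i j : Fin 2 => if i.val + j.val + 1 = 2 then (1 : L) else 0)).Local v × (cmDatum L 1 (Matrix.of fun i j : Fin 1 => if i.val + j.val + 1 = 1 then (1 : L) else 0)).Local v)).1 : ↥(unitaryGroupOfForm (galAdicCompletionMap (L := L) (IsCMField.complexConj L) hw) (placeForm (Matrix.of fun i j : Fin 2 => if i.val + j.val + 1 = 2 then (1 : L) else 0) w.1))) : GL (Fin 2) (w.1.adicCompletion L)) : Matrix (Fin 2) (Fin 2) (w.1.adicCompletion L)) := by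
    rw [← Units.val_mul, ← Units.val_mul, ← Subgroup.coe_mul, ← Subgroup.coe_mul, ← map_mul, ← map_mul, ← Prod.fst_mul, ← Prod.fst_mul, hcomm]
  -- `s₀ ≠ 0`: the descent of an invertible matrix is not zero
  have hs₀ : s₀ ≠ 0 := by
    intro h0
    rw [h0, zero_smul] at h₀
    have hX0 : (((E₂ t₀.1 : ↥(unitaryGroupOfForm (galAdicCompletionMap (L := L) (IsCMField.complexConj L) hw) (placeForm (Matrix.of fun i j : Fin 2 => if i.val + j.val + 1 = 2 then (1 : L) else 0) w.1))) : GL (Fin 2) (w.1.adicCompletion L)) : Matrix (Fin 2) (Fin 2) (w.1.adicCompletion L)) = 0 := by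
      have h := congrArg (fun Y => Matrix.diagonal ![(1 : w.1.adicCompletion L), α⁻¹] * Y * Matrix.diagonal ![1, α]) h₀
      simp only [Matrix.mul_zero, Matrix.zero_mul] at h
      rw [← h]
      simp only [Matrix.mul_assoc]
      rw [diagonal_inv_mul_diagonal hα0, Matrix.mul_one, ← Matrix.mul_assoc, diagonal_inv_mul_diagonal hα0, Matrix.one_mul]
    have hdet := ((E₂ t₀.1 : ↥(unitaryGroupOfForm (galAdicCompletionMap (L := L) (IsCMField.complexConj L) hw) (placeForm (Matrix.of fun i j : Fin 2 => if i.val + j.val + 1 = 2 then (1 : L) else 0) w.1))) : GL (Fin 2) (w.1.adicCompletion L)).isUnit.ne_zero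
    exact hdet (by rw [hX0])
  have key : (s * s₀) • ((γ : Matrix (Fin 2) (Fin 2) (v.adicCompletion ↥(maximalRealSubfield L))) * !![a₀, b₀ * v₀; b₀, a₀ + b₀ * u₀]).map (toPlace v w) =
      (s * s₀) • (!![a₀, b₀ * v₀; b₀, a₀ + b₀ * u₀] * (γ : Matrix (Fin 2) (Fin 2) (v.adicCompletion ↥(maximalRealSubfield L)))).map (toPlace v w) := by
    have h1 : (Matrix.diagonal ![1, α] * (((E₂ (t : ((cmDatum L 2 (Matrix.of fun i j : Fin 2 => if i.val + j.val + 1 = 2 then (1 : L) else 0)).Local v × (cmDatum L 1 (Matrix.of fun i j : Fin 1 => if i.val + j.val + 1 = 1 then (1 : L) else 0)).Local v)).1 : ↥(unitaryGroupOfForm (galAdicCompletionMap (L := L) (IsCMField.complexConj L) hw) (placeForm (Matrix.of fun i j : Fin 2 => if i.val + j.val + 1 = 2 then (1 : L) else 0) w.1))) : GL (Fin 2) (w.1.adicCompletion L)) : Matrix (Fin 2) (Fin 2) (w.1.adicCompletion L)) * Matrix.diagonal ![1, α⁻¹]) * (Matrix.diagonal ![1, α] * (((E₂ t₀.1 : ↥(unitaryGroupOfForm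 (galAdicCompletionMap (L := L) (IsCMField.complexConj L) hw) (placeForm (Matrix.of fun i j : Fin 2 => if i.val + j.val + 1 = 2 then (1 : L) else 0) w.1))) : GL (Fin 2) (w.1.adicCompletion L)) : Matrix (Fin 2) (Fin 2) (w.1.adicCompletion L)) * Matrix.diagonal ![1, α⁻¹]) =
        (Matrix.diagonal ![1, α] * (((E₂ t₀.1 : ↥(unitaryGroupOfForm (galAdicCompletionMap (L := L) (IsCMField.complexConj L) hw) (placeForm (Matrix.of fun i j : Fin 2 => if i.val + j.val + 1 = 2 then (1 : L) else 0) w.1))) : GL (Fin 2) (w.1.adicCompletion L)) : Matrix (Fin 2) (Fin 2) (w.1.adicCompletion L)) * Matrix.diagonal ![1, α⁻¹]) * (Matrix.diagonal ![1, α] * (((E₂ (t : ((cmDatum L 2 (Matrix.of fun i j : Fin 2 => if i.val + j.val + 1 = 2 then (1 : L) else 0)).Local v × (cmDatum L 1 (Matrix.of fun i j : Fin 1 => if i.val + j.val + 1 = 1 then (1 : L) else 0)).Local v)).1 : ↥(unitaryGroupOfForm (galAdicCompletionMap (L := L) (IsCMField.complexConj L) hw) (placeForm (Matrix.of fun i j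 : Fin 2 => if i.val + j.val + 1 = 2 then (1 : L) else 0) w.1))) : GL (Fin 2) (w.1.adicCompletion L)) : Matrix (Fin 2) (Fin 2) (w.1.adicCompletion L)) * Matrix.diagonal ![1, α⁻¹]) := by
      have e1 : ∀ X Y : Matrix (Fin 2) (Fin 2) (w.1.adicCompletion L), (Matrix.diagonal ![1, α] * X * Matrix.diagonal ![1, α⁻¹]) * (Matrix.diagonal ![1, α] * Y * Matrix.diagonal ![1, α⁻¹]) =
          Matrix.diagonal ![1, α] * (X * Y) * Matrix.diagonal ![1, α⁻¹] := by
        intro X Y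
        simp only [Matrix.mul_assoc]
        rw [← Matrix.mul_assoc (Matrix.diagonal ![1, α⁻¹]) (Matrix.diagonal ![1, α]), diagonal_inv_mul_diagonal hα0, Matrix.one_mul]
      rw [e1, e1, hXc]
    rw [hγd, h₀, Matrix.smul_mul, Matrix.mul_smul, Matrix.smul_mul, Matrix.mul_smul, smul_smul, smul_smul, ← Matrix.map_mul, ← Matrix.map_mul, mul_comm s₀ s] at h1
    exact h1
  have hγA : (γ : Matrix (Fin 2) (Fin 2) (v.adicCompletion ↥(maximalRealSubfield L))) * !![a₀, b₀ * v₀; b₀, a₀ + b₀ * u₀] = !![a₀, b₀ * v₀; b₀, a₀ + b₀ * u₀] * (γ : Matrix (Fin 2) (Fin 2) (v.adicCompletion ↥(maximalRealSubfield L))) :=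
    Matrix.map_injective (toPlace v w).injective (smul_right_injective (Matrix (Fin 2) (Fin 2) (w.1.adicCompletion L)) (mul_ne_zero hs0 hs₀) key)
  -- hence `γ` commutes with the companion matrix (`b₀ ≠ 0`)
  have hA₀ : (!![a₀, b₀ * v₀; b₀, a₀ + b₀ * u₀] : Matrix (Fin 2) (Fin 2) (v.adicCompletion ↥(maximalRealSubfield L))) = a₀ • (1 : Matrix (Fin 2) (Fin 2) (v.adicCompletion ↥(maximalRealSubfield L))) + b₀ • (γτ : Matrix (Fin 2) (Fin 2) (v.adicCompletion ↥(maximalRealSubfield L))) := by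
    rw [hγτ]
    ext i j
    fin_cases i <;> fin_cases j <;> simp
  have hγC : (γ : Matrix (Fin 2) (Fin 2) (v.adicCompletion ↥(maximalRealSubfield L))) * (γτ : Matrix (Fin 2) (Fin 2) (v.adicCompletion ↥(maximalRealSubfield L))) = (γτ : Matrix (Fin 2) (Fin 2) (v.adicCompletion ↥(maximalRealSubfield L))) * (γ : Matrix (Fin 2) (Fin 2) (v.adicCompletion ↥(maximalRealSubfield L))) := by
    rw [hA₀, Matrix.mul_add, Matrix.add_mul, Matrix.mul_smul, Matrix.smul_mul, Matrix.mul_one, Matrix.one_mul, Matrix.mul_smul, Matrix.smul_mul,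
      add_right_inj] at hγA
    exact smul_right_injective (Matrix (Fin 2) (Fin 2) (v.adicCompletion ↥(maximalRealSubfield L))) hb₀ hγA
  have hγc : γ ∈ Subgroup.centralizer ({γτ} : Set (GL (Fin 2) (v.adicCompletion ↥(maximalRealSubfield L)))) := by
    rw [Subgroup.mem_centralizer_iff]
    intro h hh
    rw [Set.mem_singleton_iff] at hh
    subst hh
    exact Units.ext hγC.symm
  obtain ⟨c, e, hce⟩ := exists_coe_eq_regRep_of_mem_centralizer_companion hγτ hγc
  exact ⟨s, γ, c, e, hce, hγd⟩

/-! ## §3 The (B6-H) head: the difference of the two orbital integrals along the elliptic torus -/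

-- `L_w`-sized statement: elaboration budget only (no search)
set_option maxHeartbeats 1600000 in
include he in
/-- **(B6-H) THE `H_v` SHELL DRESS ALONG THE ELLIPTIC TORUS** — the (W′-B6) binder `hShell` of ★-to-be `exists_wildLaw_torus_of_shellLaws` (F0P3-p01 (g14)), with
`fbar m x := ∫_{K × U(Φ₁)_v} f(k⁻¹ ((E₂⁻¹(ũ_η⁻¹ ^ m), 1)⁻¹ x (E₂⁻¹(ũ_η⁻¹ ^ m), 1)) k) dν(k)` (★ p844070's shell average) and `q = #(𝓞_{L⁺} ∕ v)`.
Data: a frame `(t₀, P, d)` of `H_v` (regular `t₀`, norm-one eigenvalues), the root `x₀ = 𝒪_v²` and its stabiliser `K` through `ρ_w ∘ E₂` (`K × U(Φ₁)_v` open), the partner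
`e = Ad(diag(1,u))` through `E₂` (`u ∈ L_wˣ` a `σ_w`-fixed unit — ★ R-0's `hvu hσu hconj`), an Eisenstein datum `(τ_E; u₀, v₀)` with integral basis, the shell element
`ũ_η = diag(η, (σ_w η)⁻¹)` (`η` a uniformiser of `L_w`), and the STANDARD-POSITION hypothesis `hpos` (architect A-45: `E₂ t₀.1` descends to a NON-SCALAR element
`s·ι(a + bτ)`, `b ≠ 0`, of the torus `{(a, b v₀; b, a + b u₀)}`; then so does every `t ∈ Z(t₀)`, §3a).  THEN there is `Mb : Z(t₀) → ℕ` such that for every regular `t ∈ Z(t₀)` and every `M₁ ≥ Mb t`: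
**`∫ f(y·↑t·y⁻¹) dν − ∫ f(y·e ↑t·y⁻¹) dν = Σ_{m ∈ range (M₁+1)} ((2·q^m : ℕ) : ℂ) · (fbar m ↑t − fbar m (e ↑t))`.**
[cite: LabesseLanglands1979, §2 p. 8] [cite: Rogawski1990, §4.9 p. 54] [cite: Kottwitz1986, §3] -/
theorem exists_bound_integral_conj_sub_eq_sum_shells_of_mem_centralizer
    (K : Subgroup ((cmDatum L 2 (Matrix.of fun i j : Fin 2 => if i.val + j.val + 1 = 2 then (1 : L) else 0)).Local v))
    (E₂ : (cmDatum L 2 (Matrix.of fun i j : Fin 2 => if i.val + j.val + 1 = 2 then (1 : L) else 0)).Local v ≃ₜ* ↥(unitaryGroupOfForm (galAdicCompletionMap (L := L) (IsCMField.complexConj L) hw) (placeForm (Matrix.of fun i j : Fin 2 => if i.val + j.val + 1 = 2 then (1 : L) else 0) w.1)))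
    (x₀ : {M : Submodule 𝒪[v.adicCompletion ↥(maximalRealSubfield L)] (Fin 2 → v.adicCompletion ↥(maximalRealSubfield L)) // IsSpecialLattice (RingHom.id _) ϖF !![(0 : v.adicCompletion ↥(maximalRealSubfield L)), 1; -1, 0] M}) (hx₀ : x₀.1 = latt (1 : Matrix (Fin 2) (Fin 2) (v.adicCompletion ↥(maximalRealSubfield L))))
    (hK : ∀ g, g ∈ K ↔ rhoVertexActPlace L v w hw hα hα0 hϖF (E₂ g) x₀ = x₀) (hKo : IsOpen ((((K.prod (⊤ : Subgroup ((cmDatum L 1 (Matrix.of fun i j : Fin 1 => if i.val + j.val + 1 = 1 then (1 : L) else 0)).Local v))) : Subgroup ((cmDatum L 2 (Matrix.of fun i j : Fin 2 => if i.val + j.val + 1 = 2 then (1 : L) else 0)).Local v × (cmDatum L 1 (Matrix.of fun i j : Fin 1 => if i.val + j.val + 1 = 1 then (1 : L) else 0)).Local v))) : Set ((cmDatum L 2 (Matrix.of fun i j : Fin 2 => if i.val + j.val + 1 = 2 then (1 : L) else 0)).Local v × (cmDatum L 1 (Matrix.of fun i j : Fin 1 => if i.val + j.val + 1 = 1 then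 (1 : L) else 0)).Local v)))
    (f : ((cmDatum L 2 (Matrix.of fun i j : Fin 2 => if i.val + j.val + 1 = 2 then (1 : L) else 0)).Local v × (cmDatum L 1 (Matrix.of fun i j : Fin 1 => if i.val + j.val + 1 = 1 then (1 : L) else 0)).Local v) → ℂ) (hf : IsLocSmooth f)
    (t₀ : ((cmDatum L 2 (Matrix.of fun i j : Fin 2 => if i.val + j.val + 1 = 2 then (1 : L) else 0)).Local v × (cmDatum L 1 (Matrix.of fun i j : Fin 1 => if i.val + j.val + 1 = 1 then (1 : L) else 0)).Local v)) (P : GL (Fin 2) (LocalRing L v)) (d : Fin 2 → (LocalRing L v)) (ht₀ : IsRegularElt (((t₀) : ((cmDatum L 2 (Matrix.of fun i j : Fin 2 => if i.val + j.val + 1 = 2 then (1 : L) else 0)).Local v × (cmDatum L 1 (Matrix.of fun i j : Fin 1 => if i.val + j.val + 1 = 1 then (1 : L) else 0)).Local v)).1.val : GL (Fin 2) (LocalRing L v)))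
    (hP : (t₀.1.val.val : Matrix (Fin 2) (Fin 2) (LocalRing L v)) * P.val = P.val * Matrix.diagonal d) (hd1 : ∀ i, conjLocal L (IsCMField.complexConj L) v (d i) * d i = 1)
    (u : (w.1.adicCompletion L)ˣ) (hvu : Valued.v (u : w.1.adicCompletion L) = 1) (hσu : galAdicCompletionMap (L := L) (IsCMField.complexConj L) hw (u : w.1.adicCompletion L) = u)
    (e : ((cmDatum L 2 (Matrix.of fun i j : Fin 2 => if i.val + j.val + 1 = 2 then (1 : L) else 0)).Local v × (cmDatum L 1 (Matrix.of fun i j : Fin 1 => if i.val + j.val + 1 = 1 then (1 : L) else 0)).Local v) ≃ₜ* ((cmDatum L 2 (Matrix.of fun i j : Fin 2 => if i.val + j.val + 1 = 2 then (1 : L) else 0)).Local v × (cmDatum L 1 (Matrix.of fun i j : Fin 1 => if i.val + j.val + 1 = 1 then (1 : L) else 0)).Local v))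
    (hconj : ∀ a : ((cmDatum L 2 (Matrix.of fun i j : Fin 2 => if i.val + j.val + 1 = 2 then (1 : L) else 0)).Local v × (cmDatum L 1 (Matrix.of fun i j : Fin 1 => if i.val + j.val + 1 = 1 then (1 : L) else 0)).Local v), ((E₂ (e a).1 : ↥(unitaryGroupOfForm (galAdicCompletionMap (L := L) (IsCMField.complexConj L) hw) (placeForm (Matrix.of fun i j : Fin 2 => if i.val + j.val + 1 = 2 then (1 : L) else 0) w.1))) : GL (Fin 2) (w.1.adicCompletion L)) = (glDiagonal 2 (w.1.adicCompletion L) ![1, u]) * ((E₂ a.1 : ↥(unitaryGroupOfForm (galAdicCompletionMap (L := L) (IsCMField.complexConj L) hw) (placeForm (Matrix.of fun i j : Fin 2 => if i.val + j.val + 1 = 2 then (1 : L) else 0) w.1))) : GL (Fin 2) (w.1.adicCompletion L)) * (glDiagonal 2 (w.1.adicCompletion L) ![1, u])⁻¹)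
    {u₀ v₀ : v.adicCompletion ↥(maximalRealSubfield L)} (hu : u₀ ∈ 𝒪[v.adicCompletion ↥(maximalRealSubfield L)]) (hu1 : valuation (v.adicCompletion ↥(maximalRealSubfield L)) u₀ < 1) (hv1 : valuation (v.adicCompletion ↥(maximalRealSubfield L)) v₀ = valuation (v.adicCompletion ↥(maximalRealSubfield L)) ϖF)
    (hE : ∀ p q : v.adicCompletion ↥(maximalRealSubfield L), valuation (v.adicCompletion ↥(maximalRealSubfield L)) (p ^ 2 + p * q * u₀ - q ^ 2 * v₀) ≤ 1 → p ∈ 𝒪[v.adicCompletion ↥(maximalRealSubfield L)] ∧ q ∈ 𝒪[v.adicCompletion ↥(maximalRealSubfield L)])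
    {τE : w.1.adicCompletion L} (hτ : τE * τE = toPlace v w u₀ * τE + toPlace v w v₀) (hστ : galAdicCompletionMap (L := L) (IsCMField.complexConj L) hw τE = toPlace v w u₀ - τE)
    (η : (w.1.adicCompletion L)ˣ) (hη : Valued.v (η : w.1.adicCompletion L) = WithZero.exp (-1 : ℤ))
    (uη : ↥(unitaryGroupOfForm (galAdicCompletionMap (L := L) (IsCMField.complexConj L) hw) (placeForm (Matrix.of fun i j : Fin 2 => if i.val + j.val + 1 = 2 then (1 : L) else 0) w.1))) (huη : (((uη : ↥(unitaryGroupOfForm (galAdicCompletionMap (L := L) (IsCMField.complexConj L) hw) (placeForm (Matrix.of fun i j : Fin 2 => if i.val + j.val + 1 = 2 then (1 : L) else 0) w.1))) : GL (Fin 2) (w.1.adicCompletion L)) : Matrix (Fin 2) (Fin 2) (w.1.adicCompletion L)) = Matrix.diagonal ![(η : w.1.adicCompletion L), (galAdicCompletionMap (L := L) (IsCMField.complexConj L) hw (η : w.1.adicCompletion L))⁻¹])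
    (hpos : ∃ (s : w.1.adicCompletion L) (a b : v.adicCompletion ↥(maximalRealSubfield L)), b ≠ 0 ∧
      Matrix.diagonal ![1, α] * (((E₂ t₀.1 : ↥(unitaryGroupOfForm (galAdicCompletionMap (L := L) (IsCMField.complexConj L) hw) (placeForm (Matrix.of fun i j : Fin 2 => if i.val + j.val + 1 = 2 then (1 : L) else 0) w.1))) : GL (Fin 2) (w.1.adicCompletion L)) : Matrix (Fin 2) (Fin 2) (w.1.adicCompletion L)) * Matrix.diagonal ![1, α⁻¹] = s • (!![a, b * v₀; b, a + b * u₀]).map (toPlace v w)) :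
    ∃ Mb : ↥(Subgroup.centralizer ({t₀} : Set ((cmDatum L 2 (Matrix.of fun i j : Fin 2 => if i.val + j.val + 1 = 2 then (1 : L) else 0)).Local v × (cmDatum L 1 (Matrix.of fun i j : Fin 1 => if i.val + j.val + 1 = 1 then (1 : L) else 0)).Local v))) → ℕ, ∀ t : ↥(Subgroup.centralizer ({t₀} : Set ((cmDatum L 2 (Matrix.of fun i j : Fin 2 => if i.val + j.val + 1 = 2 then (1 : L) else 0)).Local v × (cmDatum L 1 (Matrix.of fun i j : Fin 1 => if i.val + j.val + 1 = 1 then (1 : L) else 0)).Local v))), t ∈ {t : ↥(Subgroup.centralizer ({t₀} : Set ((cmDatum L 2 (Matrix.of fun i j : Fin 2 => if i.val + j.val + 1 = 2 then (1 : L) else 0)).Local v × (cmDatum L 1 (Matrix.of fun i j : Fin 1 => if i.val + j.val + 1 = 1 then (1 : L) else 0)).Local v))) | IsRegularElt (((t) : ((cmDatum L 2 (Matrix.of fun i j : Fin 2 => if i.val + j.val + 1 = 2 then (1 : L) else 0)).Local v × (cmDatum L 1 (Matrix.of fun i j : Fin 1 => if i.val + j.val + 1 = 1 then (1 : L) else 0)).Local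 v)).1.val : GL (Fin 2) (LocalRing L v))} → ∀ M₁ : ℕ, Mb t ≤ M₁ →
      ((∫ y, f (y * (t : ((cmDatum L 2 (Matrix.of fun i j : Fin 2 => if i.val + j.val + 1 = 2 then (1 : L) else 0)).Local v × (cmDatum L 1 (Matrix.of fun i j : Fin 1 => if i.val + j.val + 1 = 1 then (1 : L) else 0)).Local v)) * y⁻¹) ∂ν) - ∫ y, f (y * e (t : ((cmDatum L 2 (Matrix.of fun i j : Fin 2 => if i.val + j.val + 1 = 2 then (1 : L) else 0)).Local v × (cmDatum L 1 (Matrix.of fun i j : Fin 1 => if i.val + j.val + 1 = 1 then (1 : L) else 0)).Local v)) * y⁻¹) ∂ν) =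
        ∑ m ∈ Finset.range (M₁ + 1), ((2 * Nat.card (𝓞 ↥(maximalRealSubfield L) ⧸ v.asIdeal) ^ m : ℕ) : ℂ) * ((∫ k in ((((K.prod (⊤ : Subgroup ((cmDatum L 1 (Matrix.of fun i j : Fin 1 => if i.val + j.val + 1 = 1 then (1 : L) else 0)).Local v))) : Subgroup ((cmDatum L 2 (Matrix.of fun i j : Fin 2 => if i.val + j.val + 1 = 2 then (1 : L) else 0)).Local v × (cmDatum L 1 (Matrix.of fun i j : Fin 1 => if i.val + j.val + 1 = 1 then (1 : L) else 0)).Local v))) : Set ((cmDatum L 2 (Matrix.of fun i j : Fin 2 => if i.val + j.val + 1 = 2 then (1 : L) else 0)).Local v × (cmDatum L 1 (Matrix.of fun i j : Fin 1 => if i.val + j.val + 1 = 1 then (1 : L) else 0)).Local v)), f (k⁻¹ * (((E₂.symm (uη⁻¹ ^ (m)), (1 : (cmDatum L 1 (Matrix.of fun i j : Fin 1 => if i.val + j.val + 1 = 1 then (1 : L) else 0)).Local v)) : ((cmDatum L 2 (Matrix.of fun i j : Fin 2 => if i.val + j.val + 1 = 2 then (1 : L) else 0)).Local v × (cmDatum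 L 1 (Matrix.of fun i j : Fin 1 => if i.val + j.val + 1 = 1 then (1 : L) else 0)).Local v))⁻¹ * ((t : ((cmDatum L 2 (Matrix.of fun i j : Fin 2 => if i.val + j.val + 1 = 2 then (1 : L) else 0)).Local v × (cmDatum L 1 (Matrix.of fun i j : Fin 1 => if i.val + j.val + 1 = 1 then (1 : L) else 0)).Local v))) * (E₂.symm (uη⁻¹ ^ (m)), 1)) * k) ∂ν) - (∫ k in ((((K.prod (⊤ : Subgroup ((cmDatum L 1 (Matrix.of fun i j : Fin 1 => if i.val + j.val + 1 = 1 then (1 : L) else 0)).Local v))) : Subgroup ((cmDatum L 2 (Matrix.of fun i j : Fin 2 => if i.val + j.val + 1 = 2 then (1 : L) else 0)).Local v × (cmDatum L 1 (Matrix.of fun i j : Fin 1 => if i.val + j.val + 1 = 1 then (1 : L) else 0)).Local v))) : Set ((cmDatum L 2 (Matrix.of fun i j : Fin 2 => if i.val + j.val + 1 = 2 then (1 : L) else 0)).Local v × (cmDatum L 1 (Matrix.of fun i j : Fin 1 => if i.val + j.val + 1 = 1 then (1 : L) else 0)).Local v)), f (k⁻¹ * (((E₂.symm (uη⁻¹ ^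 (m)), (1 : (cmDatum L 1 (Matrix.of fun i j : Fin 1 => if i.val + j.val + 1 = 1 then (1 : L) else 0)).Local v)) : ((cmDatum L 2 (Matrix.of fun i j : Fin 2 => if i.val + j.val + 1 = 2 then (1 : L) else 0)).Local v × (cmDatum L 1 (Matrix.of fun i j : Fin 1 => if i.val + j.val + 1 = 1 then (1 : L) else 0)).Local v))⁻¹ * (e (t : ((cmDatum L 2 (Matrix.of fun i j : Fin 2 => if i.val + j.val + 1 = 2 then (1 : L) else 0)).Local v × (cmDatum L 1 (Matrix.of fun i j : Fin 1 => if i.val + j.val + 1 = 1 then (1 : L) else 0)).Local v))) * (E₂.symm (uη⁻¹ ^ (m)), 1)) * k) ∂ν)) := by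
  classical
  -- the `F`-rational form `u_F` of the `σ_w`-fixed unit `u`
  obtain ⟨uF, huF⟩ := exists_toPlace_eq_of_galAdicCompletionMap_eq (IsCMField.complexConj L) w (IsCMField.complexConj_ne_one L) hw (u : w.1.adicCompletion L) hσu
  have huF0 : uF ≠ 0 := fun h0 => u.ne_zero (by rw [← huF, h0, map_zero])
  have hvuF : valuation (v.adicCompletion ↥(maximalRealSubfield L)) uF = 1 := by
    have h := valued_toPlace_eq_sq_of_ramified L v w hw he uF
    rw [huF, hvu] at h
    have h1 : Valued.v uF = 1 := eq_one_of_sq_eq_one₃₂ h.symm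
    have h2 := (v_eq_iff_valuation_eq uF 1).1 (by rw [h1, map_one])
    rwa [map_one] at h2
  -- the rescaled datum for the partner
  obtain ⟨hu', hu1', hv1', hE'⟩ := eisenstein_rescale L v (ϖF := ϖF) hvuF hu hu1 hv1 hE
  obtain ⟨hτ', hστ'⟩ := quadDatum_rescale L v w hw huF0 hτ hστ
  -- standard position along the whole torus
  have hv0 : v₀ ≠ 0 := by
    intro h0
    rw [h0, map_zero] at hv1
    exact (isUniformizingElement_of_v_eq hϖF).ne_zero ((map_eq_zero _).1 hv1.symm)
  have hpos' := forall_exists_descent_eq_smul_regRep_of_pos L v w hw hα hα0 E₂ t₀ hv0 hpos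
  -- pointwise along the torus
  have key : ∀ t : ↥(Subgroup.centralizer ({t₀} : Set ((cmDatum L 2 (Matrix.of fun i j : Fin 2 => if i.val + j.val + 1 = 2 then (1 : L) else 0)).Local v × (cmDatum L 1 (Matrix.of fun i j : Fin 1 => if i.val + j.val + 1 = 1 then (1 : L) else 0)).Local v))), ∃ n : ℕ, IsRegularElt (((t) : ((cmDatum L 2 (Matrix.of fun i j : Fin 2 => if i.val + j.val + 1 = 2 then (1 : L) else 0)).Local v × (cmDatum L 1 (Matrix.of fun i j : Fin 1 => if i.val + j.val + 1 = 1 then (1 : L) else 0)).Local v)).1.val : GL (Fin 2) (LocalRing L v)) → ∀ M₁ : ℕ, n ≤ M₁ →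
      ((∫ y, f (y * (t : ((cmDatum L 2 (Matrix.of fun i j : Fin 2 => if i.val + j.val + 1 = 2 then (1 : L) else 0)).Local v × (cmDatum L 1 (Matrix.of fun i j : Fin 1 => if i.val + j.val + 1 = 1 then (1 : L) else 0)).Local v)) * y⁻¹) ∂ν) - ∫ y, f (y * e (t : ((cmDatum L 2 (Matrix.of fun i j : Fin 2 => if i.val + j.val + 1 = 2 then (1 : L) else 0)).Local v × (cmDatum L 1 (Matrix.of fun i j : Fin 1 => if i.val + j.val + 1 = 1 then (1 : L) else 0)).Local v)) * y⁻¹) ∂ν) =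
        ∑ m ∈ Finset.range (M₁ + 1), ((2 * Nat.card (𝓞 ↥(maximalRealSubfield L) ⧸ v.asIdeal) ^ m : ℕ) : ℂ) * ((∫ k in ((((K.prod (⊤ : Subgroup ((cmDatum L 1 (Matrix.of fun i j : Fin 1 => if i.val + j.val + 1 = 1 then (1 : L) else 0)).Local v))) : Subgroup ((cmDatum L 2 (Matrix.of fun i j : Fin 2 => if i.val + j.val + 1 = 2 then (1 : L) else 0)).Local v × (cmDatum L 1 (Matrix.of fun i j : Fin 1 => if i.val + j.val + 1 = 1 then (1 : L) else 0)).Local v))) : Set ((cmDatum L 2 (Matrix.of fun i j : Fin 2 => if i.val + j.val + 1 = 2 then (1 : L) else 0)).Local v × (cmDatum L 1 (Matrix.of fun i j : Fin 1 => if i.val + j.val + 1 = 1 then (1 : L) else 0)).Local v)), f (k⁻¹ * (((E₂.symm (uη⁻¹ ^ (m)), (1 : (cmDatum L 1 (Matrix.of fun i j : Fin 1 => if i.val + j.val + 1 = 1 then (1 : L) else 0)).Local v)) : ((cmDatum L 2 (Matrix.of fun i j : Fin 2 => if i.val + j.val + 1 = 2 then (1 : L) else 0)).Local v × (cmDatum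 L 1 (Matrix.of fun i j : Fin 1 => if i.val + j.val + 1 = 1 then (1 : L) else 0)).Local v))⁻¹ * ((t : ((cmDatum L 2 (Matrix.of fun i j : Fin 2 => if i.val + j.val + 1 = 2 then (1 : L) else 0)).Local v × (cmDatum L 1 (Matrix.of fun i j : Fin 1 => if i.val + j.val + 1 = 1 then (1 : L) else 0)).Local v))) * (E₂.symm (uη⁻¹ ^ (m)), 1)) * k) ∂ν) - (∫ k in ((((K.prod (⊤ : Subgroup ((cmDatum L 1 (Matrix.of fun i j : Fin 1 => if i.val + j.val + 1 = 1 then (1 : L) else 0)).Local v))) : Subgroup ((cmDatum L 2 (Matrix.of fun i j : Fin 2 => if i.val + j.val + 1 = 2 then (1 : L) else 0)).Local v × (cmDatum L 1 (Matrix.of fun i j : Fin 1 => if i.val + j.val + 1 = 1 then (1 : L) else 0)).Local v))) : Set ((cmDatum L 2 (Matrix.of fun i j : Fin 2 => if i.val + j.val + 1 = 2 then (1 : L) else 0)).Local v × (cmDatum L 1 (Matrix.of fun i j : Fin 1 => if i.val + j.val + 1 = 1 then (1 : L) else 0)).Local v)), f (k⁻¹ * (((E₂.symm (uη⁻¹ ^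 (m)), (1 : (cmDatum L 1 (Matrix.of fun i j : Fin 1 => if i.val + j.val + 1 = 1 then (1 : L) else 0)).Local v)) : ((cmDatum L 2 (Matrix.of fun i j : Fin 2 => if i.val + j.val + 1 = 2 then (1 : L) else 0)).Local v × (cmDatum L 1 (Matrix.of fun i j : Fin 1 => if i.val + j.val + 1 = 1 then (1 : L) else 0)).Local v))⁻¹ * (e (t : ((cmDatum L 2 (Matrix.of fun i j : Fin 2 => if i.val + j.val + 1 = 2 then (1 : L) else 0)).Local v × (cmDatum L 1 (Matrix.of fun i j : Fin 1 => if i.val + j.val + 1 = 1 then (1 : L) else 0)).Local v))) * (E₂.symm (uη⁻¹ ^ (m)), 1)) * k) ∂ν)) := by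
    intro t
    by_cases ht : IsRegularElt (((t) : ((cmDatum L 2 (Matrix.of fun i j : Fin 2 => if i.val + j.val + 1 = 2 then (1 : L) else 0)).Local v × (cmDatum L 1 (Matrix.of fun i j : Fin 1 => if i.val + j.val + 1 = 1 then (1 : L) else 0)).Local v)).1.val : GL (Fin 2) (LocalRing L v))
    · obtain ⟨s, γ, a, b, hγ, hsx⟩ := hpos' t
      -- `↑t`: standard position for `(u₀, v₀)`
      obtain ⟨B₁, hB₁⟩ := exists_integral_conj_eq_sum_shells_of_descent L v w hw hα hα0 hϖF he ν K E₂ x₀ hx₀ hK hKo hu hu1 hv1 hE hτ hστ η hη uη huη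
        (t : ((cmDatum L 2 (Matrix.of fun i j : Fin 2 => if i.val + j.val + 1 = 2 then (1 : L) else 0)).Local v × (cmDatum L 1 (Matrix.of fun i j : Fin 1 => if i.val + j.val + 1 = 1 then (1 : L) else 0)).Local v)) (isCompact_setOf_conj_mem_of_mem_centralizer L v w hw t₀ P d ht₀ hP hd1 (t : ((cmDatum L 2 (Matrix.of fun i j : Fin 2 => if i.val + j.val + 1 = 2 then (1 : L) else 0)).Local v × (cmDatum L 1 (Matrix.of fun i j : Fin 1 => if i.val + j.val + 1 = 1 then (1 : L) else 0)).Local v)) t.2 ht) hγ hsx f hf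
      -- `e ↑t`: standard position for the rescaled datum
      have hγ' : ((glDiagonal 2 (v.adicCompletion ↥(maximalRealSubfield L)) ![1, Units.mk0 uF huF0] * γ * (glDiagonal 2 (v.adicCompletion ↥(maximalRealSubfield L)) ![1, Units.mk0 uF huF0])⁻¹ : GL (Fin 2) (v.adicCompletion ↥(maximalRealSubfield L))) : Matrix (Fin 2) (Fin 2) (v.adicCompletion ↥(maximalRealSubfield L))) =
          !![a, (uF * b) * (v₀ * uF⁻¹ ^ 2); uF * b, a + (uF * b) * (u₀ * uF⁻¹)] := by
        rw [Units.val_mul, Units.val_mul, coe_glDiagonal_one_two, coe_glDiagonal_one_two_inv, Units.val_mk0, hγ]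
        exact diagonal_mul_regRep_mul_diagonal_inv huF0 a b u₀ v₀
      have hsx' : Matrix.diagonal ![1, α] * (((E₂ (e (t : ((cmDatum L 2 (Matrix.of fun i j : Fin 2 => if i.val + j.val + 1 = 2 then (1 : L) else 0)).Local v × (cmDatum L 1 (Matrix.of fun i j : Fin 1 => if i.val + j.val + 1 = 1 then (1 : L) else 0)).Local v))).1 : ↥(unitaryGroupOfForm (galAdicCompletionMap (L := L) (IsCMField.complexConj L) hw) (placeForm (Matrix.of fun i j : Fin 2 => if i.val + j.val + 1 = 2 then (1 : L) else 0) w.1))) : GL (Fin 2) (w.1.adicCompletion L)) : Matrix (Fin 2) (Fin 2) (w.1.adicCompletion L)) * Matrix.diagonal ![1, α⁻¹] =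
          s • ((glDiagonal 2 (v.adicCompletion ↥(maximalRealSubfield L)) ![1, Units.mk0 uF huF0] * γ * (glDiagonal 2 (v.adicCompletion ↥(maximalRealSubfield L)) ![1, Units.mk0 uF huF0])⁻¹ : GL (Fin 2) (v.adicCompletion ↥(maximalRealSubfield L))) : Matrix (Fin 2) (Fin 2) (v.adicCompletion ↥(maximalRealSubfield L))).map (toPlace v w) := by
        rw [hconj, Units.val_mul, Units.val_mul, coe_glDiagonal_one_two, coe_glDiagonal_one_two_inv, ← huF, Units.val_mul, Units.val_mul,
          coe_glDiagonal_one_two, coe_glDiagonal_one_two_inv, Units.val_mk0]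
        exact descent_conj_diagonal_eq (toPlace v w) α uF hsx
      obtain ⟨B₂, hB₂⟩ := exists_integral_conj_eq_sum_shells_of_descent L v w hw hα hα0 hϖF he ν K E₂ x₀ hx₀ hK hKo hu' hu1' hv1' hE' hτ' hστ' η hη uη huη
        (e (t : ((cmDatum L 2 (Matrix.of fun i j : Fin 2 => if i.val + j.val + 1 = 2 then (1 : L) else 0)).Local v × (cmDatum L 1 (Matrix.of fun i j : Fin 1 => if i.val + j.val + 1 = 1 then (1 : L) else 0)).Local v))) (isCompact_setOf_conj_map_mem_of_mem_centralizer L v w hw t₀ P d ht₀ hP hd1 e (t : ((cmDatum L 2 (Matrix.of fun i j : Fin 2 => if i.val + j.val + 1 = 2 then (1 : L) else 0)).Local v × (cmDatum L 1 (Matrix.of fun i j : Fin 1 => if i.val + j.val + 1 = 1 then (1 : L) else 0)).Local v)) t.2 ht) hγ' hsx' f hf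
      refine ⟨max B₁ B₂, fun _ M₁ hM₁ => ?_⟩
      rw [hB₁ M₁ (le_of_max_le_left hM₁), hB₂ M₁ (le_of_max_le_right hM₁), ← Finset.sum_sub_distrib]
      refine Finset.sum_congr rfl fun m _ => ?_
      rw [← smul_sub, nsmul_eq_mul, natCard_residueField_integer_adicCompletion_eq L v]
    · exact ⟨0, fun h => absurd h ht⟩
  choose Mb hMb using key
  exact ⟨Mb, fun t ht M₁ hM₁ => hMb t ht M₁ hM₁⟩

end Main

end Literature.NumberTheory.Rogawski1990

end

/-! ## ED. 2 (append-only): the head keyed on the per-`t` standard position ((B6-P)(P1)'s output currency) -/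

noncomputable section

open MeasureTheory Topology Set Function NumberField IsDedekindDomain Matrix ValuativeRel
open scoped MatrixGroups Matrix ValuativeRel Pointwise

namespace Literature.NumberTheory.Rogawski1990

open Literature.NumberTheory.Automorphic Literature.NumberTheory.Automorphic.UnitaryGroup Literature.NumberTheory.GaloisRepresentations
  Literature.NumberTheory.Automorphic.HermitianLatticeTree

section MainForall

variable (L : Type) [Field L] [NumberField L] [IsCMField L] (v : HeightOneSpectrum (𝓞 ↥(maximalRealSubfield L)))
  (w : PlacesOver L v) (hw : IsCMField.complexConj L • w.1 = w.1)
  {α : w.1.adicCompletion L} (hα : galAdicCompletionMap (L := L) (IsCMField.complexConj L) hw α = -α) (hα0 : α ≠ 0)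
  {ϖF : v.adicCompletion ↥(maximalRealSubfield L)} (hϖF : Valued.v ϖF = WithZero.exp (-1 : ℤ))
  (he : v.asIdeal.ramificationIdx' w.1.asIdeal ≠ 1)
  [MeasurableSpace ((cmDatum L 2 (Matrix.of fun i j : Fin 2 => if i.val + j.val + 1 = 2 then (1 : L) else 0)).Local v × (cmDatum L 1 (Matrix.of fun i j : Fin 1 => if i.val + j.val + 1 = 1 then (1 : L) else 0)).Local v)] [BorelSpace ((cmDatum L 2 (Matrix.of fun i j : Fin 2 => if i.val + j.val + 1 = 2 then (1 : L) else 0)).Local v × (cmDatum L 1 (Matrix.of fun i j : Fin 1 => if i.val + j.val + 1 = 1 then (1 : L) else 0)).Local v)] (ν : Measure ((cmDatum L 2 (Matrix.of fun i j : Fin 2 => if i.val + j.val + 1 = 2 then (1 : L) else 0)).Local v × (cmDatum L 1 (Matrix.of fun i j : Fin 1 => if i.val + j.val + 1 = 1 then (1 : L) else 0)).Local v)) [ν.IsHaarMeasure] [ν.IsMulRightInvariant]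

-- `L_w`-sized statement: elaboration budget only (no search)
set_option maxHeartbeats 1600000 in
include he in
/-- **(B6-H), ED. 2 — THE SAME HEAD KEYED ON THE PER-`t` STANDARD POSITION** (the OUTPUT currency of (B6-P)(P1) A-p12 (g20) ★-to-be `exists_conj_standardPosition`:
`∀ t : Z(t₀), ∃ s γ a b, ↑γ = (a, b v₀; b, a + b u₀) ∧ diag(1,α)·E₂((↑t).1)·diag(1,α)⁻¹ = s·ι(γ)`), so that the W′ END HEAD plugs (P1) in with no conversion; the (W′-B6) binder `hShell` of ★-to-be `exists_wildLaw_torus_of_shellLaws` (F0P3-p01 (g14)), with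
`fbar m x := ∫_{K × U(Φ₁)_v} f(k⁻¹ ((E₂⁻¹(ũ_η⁻¹ ^ m), 1)⁻¹ x (E₂⁻¹(ũ_η⁻¹ ^ m), 1)) k) dν(k)` (★ p844070's shell average) and `q = #(𝓞_{L⁺} ∕ v)`.
Data: a frame `(t₀, P, d)` of `H_v` (regular `t₀`, norm-one eigenvalues), the root `x₀ = 𝒪_v²` and its stabiliser `K` through `ρ_w ∘ E₂` (`K × U(Φ₁)_v` open), the partner
`e = Ad(diag(1,u))` through `E₂` (`u ∈ L_wˣ` a `σ_w`-fixed unit — ★ R-0's `hvu hσu hconj`), an Eisenstein datum `(τ_E; u₀, v₀)` with integral basis, the shell element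
`ũ_η = diag(η, (σ_w η)⁻¹)` (`η` a uniformiser of `L_w`), and the STANDARD-POSITION hypothesis `hpos` (architect A-45: `E₂ t₀.1` descends to a NON-SCALAR element
`s·ι(a + bτ)`, `b ≠ 0`, of the torus `{(a, b v₀; b, a + b u₀)}`; then so does every `t ∈ Z(t₀)`, §3a).  THEN there is `Mb : Z(t₀) → ℕ` such that for every regular `t ∈ Z(t₀)` and every `M₁ ≥ Mb t`:
**`∫ f(y·↑t·y⁻¹) dν − ∫ f(y·e ↑t·y⁻¹) dν = Σ_{m ∈ range (M₁+1)} ((2·q^m : ℕ) : ℂ) · (fbar m ↑t − fbar m (e ↑t))`.**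
[cite: LabesseLanglands1979, §2 p. 8] [cite: Rogawski1990, §4.9 p. 54] [cite: Kottwitz1986, §3] -/
theorem exists_bound_integral_conj_sub_eq_sum_shells_of_forall_descent
    (K : Subgroup ((cmDatum L 2 (Matrix.of fun i j : Fin 2 => if i.val + j.val + 1 = 2 then (1 : L) else 0)).Local v))
    (E₂ : (cmDatum L 2 (Matrix.of fun i j : Fin 2 => if i.val + j.val + 1 = 2 then (1 : L) else 0)).Local v ≃ₜ* ↥(unitaryGroupOfForm (galAdicCompletionMap (L := L) (IsCMField.complexConj L) hw) (placeForm (Matrix.of fun i j : Fin 2 => if i.val + j.val + 1 = 2 then (1 : L) else 0) w.1)))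
    (x₀ : {M : Submodule 𝒪[v.adicCompletion ↥(maximalRealSubfield L)] (Fin 2 → v.adicCompletion ↥(maximalRealSubfield L)) // IsSpecialLattice (RingHom.id _) ϖF !![(0 : v.adicCompletion ↥(maximalRealSubfield L)), 1; -1, 0] M}) (hx₀ : x₀.1 = latt (1 : Matrix (Fin 2) (Fin 2) (v.adicCompletion ↥(maximalRealSubfield L))))
    (hK : ∀ g, g ∈ K ↔ rhoVertexActPlace L v w hw hα hα0 hϖF (E₂ g) x₀ = x₀) (hKo : IsOpen ((((K.prod (⊤ : Subgroup ((cmDatum L 1 (Matrix.of fun i j : Fin 1 => if i.val + j.val + 1 = 1 then (1 : L) else 0)).Local v))) : Subgroup ((cmDatum L 2 (Matrix.of fun i j : Fin 2 => if i.val + j.val + 1 = 2 then (1 : L) else 0)).Local v × (cmDatum L 1 (Matrix.of fun i j : Fin 1 => if i.val + j.val + 1 = 1 then (1 : L) else 0)).Local v))) : Set ((cmDatum L 2 (Matrix.of fun i j : Fin 2 => if i.val + j.val + 1 = 2 then (1 : L) else 0)).Local v × (cmDatum L 1 (Matrix.of fun i j : Fin 1 => if i.val + j.val + 1 = 1 then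 (1 : L) else 0)).Local v)))
    (f : ((cmDatum L 2 (Matrix.of fun i j : Fin 2 => if i.val + j.val + 1 = 2 then (1 : L) else 0)).Local v × (cmDatum L 1 (Matrix.of fun i j : Fin 1 => if i.val + j.val + 1 = 1 then (1 : L) else 0)).Local v) → ℂ) (hf : IsLocSmooth f)
    (t₀ : ((cmDatum L 2 (Matrix.of fun i j : Fin 2 => if i.val + j.val + 1 = 2 then (1 : L) else 0)).Local v × (cmDatum L 1 (Matrix.of fun i j : Fin 1 => if i.val + j.val + 1 = 1 then (1 : L) else 0)).Local v)) (P : GL (Fin 2) (LocalRing L v)) (d : Fin 2 → (LocalRing L v)) (ht₀ : IsRegularElt (((t₀) : ((cmDatum L 2 (Matrix.of fun i j : Fin 2 => if i.val + j.val + 1 = 2 then (1 : L) else 0)).Local v × (cmDatum L 1 (Matrix.of fun i j : Fin 1 => if i.val + j.val + 1 = 1 then (1 : L) else 0)).Local v)).1.val : GL (Fin 2) (LocalRing L v)))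
    (hP : (t₀.1.val.val : Matrix (Fin 2) (Fin 2) (LocalRing L v)) * P.val = P.val * Matrix.diagonal d) (hd1 : ∀ i, conjLocal L (IsCMField.complexConj L) v (d i) * d i = 1)
    (u : (w.1.adicCompletion L)ˣ) (hvu : Valued.v (u : w.1.adicCompletion L) = 1) (hσu : galAdicCompletionMap (L := L) (IsCMField.complexConj L) hw (u : w.1.adicCompletion L) = u)
    (e : ((cmDatum L 2 (Matrix.of fun i j : Fin 2 => if i.val + j.val + 1 = 2 then (1 : L) else 0)).Local v × (cmDatum L 1 (Matrix.of fun i j : Fin 1 => if i.val + j.val + 1 = 1 then (1 : L) else 0)).Local v) ≃ₜ* ((cmDatum L 2 (Matrix.of fun i j : Fin 2 => if i.val + j.val + 1 = 2 then (1 : L) else 0)).Local v × (cmDatum L 1 (Matrix.of fun i j : Fin 1 => if i.val + j.val + 1 = 1 then (1 : L) else 0)).Local v))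
    (hconj : ∀ a : ((cmDatum L 2 (Matrix.of fun i j : Fin 2 => if i.val + j.val + 1 = 2 then (1 : L) else 0)).Local v × (cmDatum L 1 (Matrix.of fun i j : Fin 1 => if i.val + j.val + 1 = 1 then (1 : L) else 0)).Local v), ((E₂ (e a).1 : ↥(unitaryGroupOfForm (galAdicCompletionMap (L := L) (IsCMField.complexConj L) hw) (placeForm (Matrix.of fun i j : Fin 2 => if i.val + j.val + 1 = 2 then (1 : L) else 0) w.1))) : GL (Fin 2) (w.1.adicCompletion L)) = (glDiagonal 2 (w.1.adicCompletion L) ![1, u]) * ((E₂ a.1 : ↥(unitaryGroupOfForm (galAdicCompletionMap (L := L) (IsCMField.complexConj L) hw) (placeForm (Matrix.of fun i j : Fin 2 => if i.val + j.val + 1 = 2 then (1 : L) else 0) w.1))) : GL (Fin 2) (w.1.adicCompletion L)) * (glDiagonal 2 (w.1.adicCompletion L) ![1, u])⁻¹)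
    {u₀ v₀ : v.adicCompletion ↥(maximalRealSubfield L)} (hu : u₀ ∈ 𝒪[v.adicCompletion ↥(maximalRealSubfield L)]) (hu1 : valuation (v.adicCompletion ↥(maximalRealSubfield L)) u₀ < 1) (hv1 : valuation (v.adicCompletion ↥(maximalRealSubfield L)) v₀ = valuation (v.adicCompletion ↥(maximalRealSubfield L)) ϖF)
    (hE : ∀ p q : v.adicCompletion ↥(maximalRealSubfield L), valuation (v.adicCompletion ↥(maximalRealSubfield L)) (p ^ 2 + p * q * u₀ - q ^ 2 * v₀) ≤ 1 → p ∈ 𝒪[v.adicCompletion ↥(maximalRealSubfield L)] ∧ q ∈ 𝒪[v.adicCompletion ↥(maximalRealSubfield L)])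
    {τE : w.1.adicCompletion L} (hτ : τE * τE = toPlace v w u₀ * τE + toPlace v w v₀) (hστ : galAdicCompletionMap (L := L) (IsCMField.complexConj L) hw τE = toPlace v w u₀ - τE)
    (η : (w.1.adicCompletion L)ˣ) (hη : Valued.v (η : w.1.adicCompletion L) = WithZero.exp (-1 : ℤ))
    (uη : ↥(unitaryGroupOfForm (galAdicCompletionMap (L := L) (IsCMField.complexConj L) hw) (placeForm (Matrix.of fun i j : Fin 2 => if i.val + j.val + 1 = 2 then (1 : L) else 0) w.1))) (huη : (((uη : ↥(unitaryGroupOfForm (galAdicCompletionMap (L := L) (IsCMField.complexConj L) hw) (placeForm (Matrix.of fun i j : Fin 2 => if i.val + j.val + 1 = 2 then (1 : L) else 0) w.1))) : GL (Fin 2) (w.1.adicCompletion L)) : Matrix (Fin 2) (Fin 2) (w.1.adicCompletion L)) = Matrix.diagonal ![(η : w.1.adicCompletion L), (galAdicCompletionMap (L := L) (IsCMField.complexConj L) hw (η : w.1.adicCompletion L))⁻¹])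
    (hpos : ∀ t : ↥(Subgroup.centralizer ({t₀} : Set ((cmDatum L 2 (Matrix.of fun i j : Fin 2 => if i.val + j.val + 1 = 2 then (1 : L) else 0)).Local v × (cmDatum L 1 (Matrix.of fun i j : Fin 1 => if i.val + j.val + 1 = 1 then (1 : L) else 0)).Local v))), ∃ (s : w.1.adicCompletion L) (γ : GL (Fin 2) (v.adicCompletion ↥(maximalRealSubfield L))) (a b : v.adicCompletion ↥(maximalRealSubfield L)), (γ : Matrix (Fin 2) (Fin 2) (v.adicCompletion ↥(maximalRealSubfield L))) = !![a, b * v₀; b, a + b * u₀] ∧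
      Matrix.diagonal ![1, α] * (((E₂ (t : ((cmDatum L 2 (Matrix.of fun i j : Fin 2 => if i.val + j.val + 1 = 2 then (1 : L) else 0)).Local v × (cmDatum L 1 (Matrix.of fun i j : Fin 1 => if i.val + j.val + 1 = 1 then (1 : L) else 0)).Local v)).1 : ↥(unitaryGroupOfForm (galAdicCompletionMap (L := L) (IsCMField.complexConj L) hw) (placeForm (Matrix.of fun i j : Fin 2 => if i.val + j.val + 1 = 2 then (1 : L) else 0) w.1))) : GL (Fin 2) (w.1.adicCompletion L)) : Matrix (Fin 2) (Fin 2) (w.1.adicCompletion L)) * Matrix.diagonal ![1, α⁻¹] = s • (γ : Matrix (Fin 2) (Fin 2) (v.adicCompletion ↥(maximalRealSubfield L))).map (toPlace v w)) :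
    ∃ Mb : ↥(Subgroup.centralizer ({t₀} : Set ((cmDatum L 2 (Matrix.of fun i j : Fin 2 => if i.val + j.val + 1 = 2 then (1 : L) else 0)).Local v × (cmDatum L 1 (Matrix.of fun i j : Fin 1 => if i.val + j.val + 1 = 1 then (1 : L) else 0)).Local v))) → ℕ, ∀ t : ↥(Subgroup.centralizer ({t₀} : Set ((cmDatum L 2 (Matrix.of fun i j : Fin 2 => if i.val + j.val + 1 = 2 then (1 : L) else 0)).Local v × (cmDatum L 1 (Matrix.of fun i j : Fin 1 => if i.val + j.val + 1 = 1 then (1 : L) else 0)).Local v))), t ∈ {t : ↥(Subgroup.centralizer ({t₀} : Set ((cmDatum L 2 (Matrix.of fun i j : Fin 2 => if i.val + j.val + 1 = 2 then (1 : L) else 0)).Local v × (cmDatum L 1 (Matrix.of fun i j : Fin 1 => if i.val + j.val + 1 = 1 then (1 : L) else 0)).Local v))) | IsRegularElt (((t) : ((cmDatum L 2 (Matrix.of fun i j : Fin 2 => if i.val + j.val + 1 = 2 then (1 : L) else 0)).Local v × (cmDatum L 1 (Matrix.of fun i j : Fin 1 => if i.val + j.val + 1 = 1 then (1 : L) else 0)).Local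 v)).1.val : GL (Fin 2) (LocalRing L v))} → ∀ M₁ : ℕ, Mb t ≤ M₁ →
      ((∫ y, f (y * (t : ((cmDatum L 2 (Matrix.of fun i j : Fin 2 => if i.val + j.val + 1 = 2 then (1 : L) else 0)).Local v × (cmDatum L 1 (Matrix.of fun i j : Fin 1 => if i.val + j.val + 1 = 1 then (1 : L) else 0)).Local v)) * y⁻¹) ∂ν) - ∫ y, f (y * e (t : ((cmDatum L 2 (Matrix.of fun i j : Fin 2 => if i.val + j.val + 1 = 2 then (1 : L) else 0)).Local v × (cmDatum L 1 (Matrix.of fun i j : Fin 1 => if i.val + j.val + 1 = 1 then (1 : L) else 0)).Local v)) * y⁻¹) ∂ν) =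
        ∑ m ∈ Finset.range (M₁ + 1), ((2 * Nat.card (𝓞 ↥(maximalRealSubfield L) ⧸ v.asIdeal) ^ m : ℕ) : ℂ) * ((∫ k in ((((K.prod (⊤ : Subgroup ((cmDatum L 1 (Matrix.of fun i j : Fin 1 => if i.val + j.val + 1 = 1 then (1 : L) else 0)).Local v))) : Subgroup ((cmDatum L 2 (Matrix.of fun i j : Fin 2 => if i.val + j.val + 1 = 2 then (1 : L) else 0)).Local v × (cmDatum L 1 (Matrix.of fun i j : Fin 1 => if i.val + j.val + 1 = 1 then (1 : L) else 0)).Local v))) : Set ((cmDatum L 2 (Matrix.of fun i j : Fin 2 => if i.val + j.val + 1 = 2 then (1 : L) else 0)).Local v × (cmDatum L 1 (Matrix.of fun i j : Fin 1 => if i.val + j.val + 1 = 1 then (1 : L) else 0)).Local v)), f (k⁻¹ * (((E₂.symm (uη⁻¹ ^ (m)), (1 : (cmDatum L 1 (Matrix.of fun i j : Fin 1 => if i.val + j.val + 1 = 1 then (1 : L) else 0)).Local v)) : ((cmDatum L 2 (Matrix.of fun i j : Fin 2 => if i.val + j.val + 1 = 2 then (1 : L) else 0)).Local v × (cmDatum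 L 1 (Matrix.of fun i j : Fin 1 => if i.val + j.val + 1 = 1 then (1 : L) else 0)).Local v))⁻¹ * ((t : ((cmDatum L 2 (Matrix.of fun i j : Fin 2 => if i.val + j.val + 1 = 2 then (1 : L) else 0)).Local v × (cmDatum L 1 (Matrix.of fun i j : Fin 1 => if i.val + j.val + 1 = 1 then (1 : L) else 0)).Local v))) * (E₂.symm (uη⁻¹ ^ (m)), 1)) * k) ∂ν) - (∫ k in ((((K.prod (⊤ : Subgroup ((cmDatum L 1 (Matrix.of fun i j : Fin 1 => if i.val + j.val + 1 = 1 then (1 : L) else 0)).Local v))) : Subgroup ((cmDatum L 2 (Matrix.of fun i j : Fin 2 => if i.val + j.val + 1 = 2 then (1 : L) else 0)).Local v × (cmDatum L 1 (Matrix.of fun i j : Fin 1 => if i.val + j.val + 1 = 1 then (1 : L) else 0)).Local v))) : Set ((cmDatum L 2 (Matrix.of fun i j : Fin 2 => if i.val + j.val + 1 = 2 then (1 : L) else 0)).Local v × (cmDatum L 1 (Matrix.of fun i j : Fin 1 => if i.val + j.val + 1 = 1 then (1 : L) else 0)).Local v)), f (k⁻¹ * (((E₂.symm (uη⁻¹ ^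 (m)), (1 : (cmDatum L 1 (Matrix.of fun i j : Fin 1 => if i.val + j.val + 1 = 1 then (1 : L) else 0)).Local v)) : ((cmDatum L 2 (Matrix.of fun i j : Fin 2 => if i.val + j.val + 1 = 2 then (1 : L) else 0)).Local v × (cmDatum L 1 (Matrix.of fun i j : Fin 1 => if i.val + j.val + 1 = 1 then (1 : L) else 0)).Local v))⁻¹ * (e (t : ((cmDatum L 2 (Matrix.of fun i j : Fin 2 => if i.val + j.val + 1 = 2 then (1 : L) else 0)).Local v × (cmDatum L 1 (Matrix.of fun i j : Fin 1 => if i.val + j.val + 1 = 1 then (1 : L) else 0)).Local v))) * (E₂.symm (uη⁻¹ ^ (m)), 1)) * k) ∂ν)) := by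
  classical
  -- the `F`-rational form `u_F` of the `σ_w`-fixed unit `u`
  obtain ⟨uF, huF⟩ := exists_toPlace_eq_of_galAdicCompletionMap_eq (IsCMField.complexConj L) w (IsCMField.complexConj_ne_one L) hw (u : w.1.adicCompletion L) hσu
  have huF0 : uF ≠ 0 := fun h0 => u.ne_zero (by rw [← huF, h0, map_zero])
  have hvuF : valuation (v.adicCompletion ↥(maximalRealSubfield L)) uF = 1 := by
    have h := valued_toPlace_eq_sq_of_ramified L v w hw he uF
    rw [huF, hvu] at h
    have h1 : Valued.v uF = 1 := eq_one_of_sq_eq_one₃₂ h.symm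
    have h2 := (v_eq_iff_valuation_eq uF 1).1 (by rw [h1, map_one])
    rwa [map_one] at h2
  -- the rescaled datum for the partner
  obtain ⟨hu', hu1', hv1', hE'⟩ := eisenstein_rescale L v (ϖF := ϖF) hvuF hu hu1 hv1 hE
  obtain ⟨hτ', hστ'⟩ := quadDatum_rescale L v w hw huF0 hτ hστ
  -- pointwise along the torus
  have key : ∀ t : ↥(Subgroup.centralizer ({t₀} : Set ((cmDatum L 2 (Matrix.of fun i j : Fin 2 => if i.val + j.val + 1 = 2 then (1 : L) else 0)).Local v × (cmDatum L 1 (Matrix.of fun i j : Fin 1 => if i.val + j.val + 1 = 1 then (1 : L) else 0)).Local v))), ∃ n : ℕ, IsRegularElt (((t) : ((cmDatum L 2 (Matrix.of fun i j : Fin 2 => if i.val + j.val + 1 = 2 then (1 : L) else 0)).Local v × (cmDatum L 1 (Matrix.of fun i j : Fin 1 => if i.val + j.val + 1 = 1 then (1 : L) else 0)).Local v)).1.val : GL (Fin 2) (LocalRing L v)) → ∀ M₁ : ℕ, n ≤ M₁ →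
      ((∫ y, f (y * (t : ((cmDatum L 2 (Matrix.of fun i j : Fin 2 => if i.val + j.val + 1 = 2 then (1 : L) else 0)).Local v × (cmDatum L 1 (Matrix.of fun i j : Fin 1 => if i.val + j.val + 1 = 1 then (1 : L) else 0)).Local v)) * y⁻¹) ∂ν) - ∫ y, f (y * e (t : ((cmDatum L 2 (Matrix.of fun i j : Fin 2 => if i.val + j.val + 1 = 2 then (1 : L) else 0)).Local v × (cmDatum L 1 (Matrix.of fun i j : Fin 1 => if i.val + j.val + 1 = 1 then (1 : L) else 0)).Local v)) * y⁻¹) ∂ν) =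
        ∑ m ∈ Finset.range (M₁ + 1), ((2 * Nat.card (𝓞 ↥(maximalRealSubfield L) ⧸ v.asIdeal) ^ m : ℕ) : ℂ) * ((∫ k in ((((K.prod (⊤ : Subgroup ((cmDatum L 1 (Matrix.of fun i j : Fin 1 => if i.val + j.val + 1 = 1 then (1 : L) else 0)).Local v))) : Subgroup ((cmDatum L 2 (Matrix.of fun i j : Fin 2 => if i.val + j.val + 1 = 2 then (1 : L) else 0)).Local v × (cmDatum L 1 (Matrix.of fun i j : Fin 1 => if i.val + j.val + 1 = 1 then (1 : L) else 0)).Local v))) : Set ((cmDatum L 2 (Matrix.of fun i j : Fin 2 => if i.val + j.val + 1 = 2 then (1 : L) else 0)).Local v × (cmDatum L 1 (Matrix.of fun i j : Fin 1 => if i.val + j.val + 1 = 1 then (1 : L) else 0)).Local v)), f (k⁻¹ * (((E₂.symm (uη⁻¹ ^ (m)), (1 : (cmDatum L 1 (Matrix.of fun i j : Fin 1 => if i.val + j.val + 1 = 1 then (1 : L) else 0)).Local v)) : ((cmDatum L 2 (Matrix.of fun i j : Fin 2 => if i.val + j.val + 1 = 2 then (1 : L) else 0)).Local v × (cmDatum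 L 1 (Matrix.of fun i j : Fin 1 => if i.val + j.val + 1 = 1 then (1 : L) else 0)).Local v))⁻¹ * ((t : ((cmDatum L 2 (Matrix.of fun i j : Fin 2 => if i.val + j.val + 1 = 2 then (1 : L) else 0)).Local v × (cmDatum L 1 (Matrix.of fun i j : Fin 1 => if i.val + j.val + 1 = 1 then (1 : L) else 0)).Local v))) * (E₂.symm (uη⁻¹ ^ (m)), 1)) * k) ∂ν) - (∫ k in ((((K.prod (⊤ : Subgroup ((cmDatum L 1 (Matrix.of fun i j : Fin 1 => if i.val + j.val + 1 = 1 then (1 : L) else 0)).Local v))) : Subgroup ((cmDatum L 2 (Matrix.of fun i j : Fin 2 => if i.val + j.val + 1 = 2 then (1 : L) else 0)).Local v × (cmDatum L 1 (Matrix.of fun i j : Fin 1 => if i.val + j.val + 1 = 1 then (1 : L) else 0)).Local v))) : Set ((cmDatum L 2 (Matrix.of fun i j : Fin 2 => if i.val + j.val + 1 = 2 then (1 : L) else 0)).Local v × (cmDatum L 1 (Matrix.of fun i j : Fin 1 => if i.val + j.val + 1 = 1 then (1 : L) else 0)).Local v)), f (k⁻¹ * (((E₂.symm (uη⁻¹ ^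 (m)), (1 : (cmDatum L 1 (Matrix.of fun i j : Fin 1 => if i.val + j.val + 1 = 1 then (1 : L) else 0)).Local v)) : ((cmDatum L 2 (Matrix.of fun i j : Fin 2 => if i.val + j.val + 1 = 2 then (1 : L) else 0)).Local v × (cmDatum L 1 (Matrix.of fun i j : Fin 1 => if i.val + j.val + 1 = 1 then (1 : L) else 0)).Local v))⁻¹ * (e (t : ((cmDatum L 2 (Matrix.of fun i j : Fin 2 => if i.val + j.val + 1 = 2 then (1 : L) else 0)).Local v × (cmDatum L 1 (Matrix.of fun i j : Fin 1 => if i.val + j.val + 1 = 1 then (1 : L) else 0)).Local v))) * (E₂.symm (uη⁻¹ ^ (m)), 1)) * k) ∂ν)) := by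
    intro t
    by_cases ht : IsRegularElt (((t) : ((cmDatum L 2 (Matrix.of fun i j : Fin 2 => if i.val + j.val + 1 = 2 then (1 : L) else 0)).Local v × (cmDatum L 1 (Matrix.of fun i j : Fin 1 => if i.val + j.val + 1 = 1 then (1 : L) else 0)).Local v)).1.val : GL (Fin 2) (LocalRing L v))
    · obtain ⟨s, γ, a, b, hγ, hsx⟩ := hpos t
      -- `↑t`: standard position for `(u₀, v₀)`
      obtain ⟨B₁, hB₁⟩ := exists_integral_conj_eq_sum_shells_of_descent L v w hw hα hα0 hϖF he ν K E₂ x₀ hx₀ hK hKo hu hu1 hv1 hE hτ hστ η hη uη huη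
        (t : ((cmDatum L 2 (Matrix.of fun i j : Fin 2 => if i.val + j.val + 1 = 2 then (1 : L) else 0)).Local v × (cmDatum L 1 (Matrix.of fun i j : Fin 1 => if i.val + j.val + 1 = 1 then (1 : L) else 0)).Local v)) (isCompact_setOf_conj_mem_of_mem_centralizer L v w hw t₀ P d ht₀ hP hd1 (t : ((cmDatum L 2 (Matrix.of fun i j : Fin 2 => if i.val + j.val + 1 = 2 then (1 : L) else 0)).Local v × (cmDatum L 1 (Matrix.of fun i j : Fin 1 => if i.val + j.val + 1 = 1 then (1 : L) else 0)).Local v)) t.2 ht) hγ hsx f hf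
      -- `e ↑t`: standard position for the rescaled datum
      have hγ' : ((glDiagonal 2 (v.adicCompletion ↥(maximalRealSubfield L)) ![1, Units.mk0 uF huF0] * γ * (glDiagonal 2 (v.adicCompletion ↥(maximalRealSubfield L)) ![1, Units.mk0 uF huF0])⁻¹ : GL (Fin 2) (v.adicCompletion ↥(maximalRealSubfield L))) : Matrix (Fin 2) (Fin 2) (v.adicCompletion ↥(maximalRealSubfield L))) =
          !![a, (uF * b) * (v₀ * uF⁻¹ ^ 2); uF * b, a + (uF * b) * (u₀ * uF⁻¹)] := by
        rw [Units.val_mul, Units.val_mul, coe_glDiagonal_one_two, coe_glDiagonal_one_two_inv, Units.val_mk0, hγ]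
        exact diagonal_mul_regRep_mul_diagonal_inv huF0 a b u₀ v₀
      have hsx' : Matrix.diagonal ![1, α] * (((E₂ (e (t : ((cmDatum L 2 (Matrix.of fun i j : Fin 2 => if i.val + j.val + 1 = 2 then (1 : L) else 0)).Local v × (cmDatum L 1 (Matrix.of fun i j : Fin 1 => if i.val + j.val + 1 = 1 then (1 : L) else 0)).Local v))).1 : ↥(unitaryGroupOfForm (galAdicCompletionMap (L := L) (IsCMField.complexConj L) hw) (placeForm (Matrix.of fun i j : Fin 2 => if i.val + j.val + 1 = 2 then (1 : L) else 0) w.1))) : GL (Fin 2) (w.1.adicCompletion L)) : Matrix (Fin 2) (Fin 2) (w.1.adicCompletion L)) * Matrix.diagonal ![1, α⁻¹] =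
          s • ((glDiagonal 2 (v.adicCompletion ↥(maximalRealSubfield L)) ![1, Units.mk0 uF huF0] * γ * (glDiagonal 2 (v.adicCompletion ↥(maximalRealSubfield L)) ![1, Units.mk0 uF huF0])⁻¹ : GL (Fin 2) (v.adicCompletion ↥(maximalRealSubfield L))) : Matrix (Fin 2) (Fin 2) (v.adicCompletion ↥(maximalRealSubfield L))).map (toPlace v w) := by
        rw [hconj, Units.val_mul, Units.val_mul, coe_glDiagonal_one_two, coe_glDiagonal_one_two_inv, ← huF, Units.val_mul, Units.val_mul,
          coe_glDiagonal_one_two, coe_glDiagonal_one_two_inv, Units.val_mk0]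
        exact descent_conj_diagonal_eq (toPlace v w) α uF hsx
      obtain ⟨B₂, hB₂⟩ := exists_integral_conj_eq_sum_shells_of_descent L v w hw hα hα0 hϖF he ν K E₂ x₀ hx₀ hK hKo hu' hu1' hv1' hE' hτ' hστ' η hη uη huη
        (e (t : ((cmDatum L 2 (Matrix.of fun i j : Fin 2 => if i.val + j.val + 1 = 2 then (1 : L) else 0)).Local v × (cmDatum L 1 (Matrix.of fun i j : Fin 1 => if i.val + j.val + 1 = 1 then (1 : L) else 0)).Local v))) (isCompact_setOf_conj_map_mem_of_mem_centralizer L v w hw t₀ P d ht₀ hP hd1 e (t : ((cmDatum L 2 (Matrix.of fun i j : Fin 2 => if i.val + j.val + 1 = 2 then (1 : L) else 0)).Local v × (cmDatum L 1 (Matrix.of fun i j : Fin 1 => if i.val + j.val + 1 = 1 then (1 : L) else 0)).Local v)) t.2 ht) hγ' hsx' f hf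
      refine ⟨max B₁ B₂, fun _ M₁ hM₁ => ?_⟩
      rw [hB₁ M₁ (le_of_max_le_left hM₁), hB₂ M₁ (le_of_max_le_right hM₁), ← Finset.sum_sub_distrib]
      refine Finset.sum_congr rfl fun m _ => ?_
      rw [← smul_sub, nsmul_eq_mul, natCard_residueField_integer_adicCompletion_eq L v]
    · exact ⟨0, fun h => absurd h ht⟩
  choose Mb hMb using key
  exact ⟨Mb, fun t ht M₁ hM₁ => hMb t ht M₁ hM₁⟩

end MainForall

end Literature.NumberTheory.Rogawski1990

end

/-! ## ED. 3 (append-only): the glue between an existential support bound and the window top of the value laws (`hjo`'s second clause of ★ p844200) -/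

namespace Literature.NumberTheory.Rogawski1990

/-- **SHELL SUMS ARE STABLE BEYOND THE SUPPORT — the `Mb`-glue for ★ `exists_wildLaw_torus_of_shellLaws`.**  If an identity `O t = Σ_{m ≤ M₁} c_m · A_m(t)` holds for
all `M₁` beyond SOME bound `Mb₀ t` (the existential bound of ★ `exists_bound_integral_conj_sub_eq_sum_shells_of_mem_centralizer`), and on the «good» locus the terms
vanish above a window top `top t` (the value laws' `htop`), then there is ONE bound `Mb` with BOTH `Mb t ≤ top t` on the good locus (the fold's `hjo`, second clause)
AND the identity for all `M₁ ≥ Mb t` (the fold's `hShell`): take `Mb t := top t` on the good locus and `Mb₀ t` elsewhere; the extra terms between `M₁` and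
`max M₁ (Mb₀ t)` vanish. [cite: LabesseLanglands1979, §2 p. 8] -/
theorem exists_bound_le_top_and_eq_sum_of_eq_sum_of_top {Z : Type*} (U : Set Z) (good : Z → Prop) (O : Z → ℂ) (c : ℕ → ℂ) (A : ℕ → Z → ℂ)
    (Mb₀ top : Z → ℕ)
    (hShell₀ : ∀ t, t ∈ U → ∀ M₁ : ℕ, Mb₀ t ≤ M₁ → O t = ∑ m ∈ Finset.range (M₁ + 1), c m * A m t)
    (htop : ∀ t, t ∈ U → good t → ∀ m : ℕ, top t < m → A m t = 0) :
    ∃ Mb : Z → ℕ, (∀ t, t ∈ U → good t → Mb t ≤ top t) ∧ (∀ t, t ∈ U → ∀ M₁ : ℕ, Mb t ≤ M₁ → O t = ∑ m ∈ Finset.range (M₁ + 1), c m * A m t) := by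
  classical
  refine ⟨fun t => if good t then top t else Mb₀ t, fun t _ hg => by simp only [if_pos hg, le_refl], fun t ht M₁ hM₁ => ?_⟩
  by_cases hg : good t
  · simp only [if_pos hg] at hM₁
    -- go up to `max M₁ (Mb₀ t)` where `hShell₀` applies, then drop the vanishing tail
    rw [hShell₀ t ht (max M₁ (Mb₀ t)) (le_max_right _ _)]
    symm
    refine Finset.sum_subset (fun x hx => Finset.mem_range.2 (lt_of_lt_of_le (Finset.mem_range.1 hx) (Nat.succ_le_succ (le_max_left _ _)))) fun m hm hm' => ?_
    have hlt : top t < m := by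
      rw [Finset.mem_range, not_lt] at hm'
      omega
    rw [htop t ht hg m hlt, mul_zero]
  · simp only [if_neg hg] at hM₁
    exact hShell₀ t ht M₁ hM₁

end Literature.NumberTheory.Rogawski1990
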